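import Literature.NumberTheory.Transcendental.CijsouwWaldschmidt1977Setup
import Literature.NumberTheory.Transcendental.CijsouwWaldschmidt1977Liouville
import Literature.NumberTheory.Transcendental.CijsouwWaldschmidt1977Points
import Literature.NumberTheory.Transcendental.HermiteInterpolationBound
import Literature.NumberTheory.Transcendental.BakerQuantVandermonde
import Mathlib.NumberTheory.SiegelsLemma
import HarnessLib

/-!
# Cijsouw–Waldschmidt 1977 over `ℚ` (`p = 2`): the algebra of one step of the `2`-descent

Support file (plain definitions and theorems; no named fact) for the proof of Cijsouw–Waldschmidt
1977, Proposition 1 over `ℚ` with `p = 2` — the archimedean input of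
`Literature.Barriers.ABC.BakerMethodBounds` (`BakerMethodBoundsKummerArchSymmProofs.lean`,
hypothesis `hW₃`), discharged in `CijsouwWaldschmidt1977Main.lean`.

From the vanishing of `φ_{J,τ}` at the half-integers `s/2` (`s` odd) to the relations of level
`J + 1` (pp. 189–191): expression of `φ_{J,τ}(s/2)` on the monomials `∏_{i∈T} √αᵢ` with
rational coefficients (the class sums), vanishing of every class sum by the independence of the
monomials (the `2`-Kummer condition), choice of a residue class carrying a non-zero unknown,
re-indexing `λ = λ⁰ + 2μ`, and the recentring `γⱼ(λ⁰ + 2μ) = 2(γⱼ(μ) + cⱼ)` of the derivative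
polynomials (p. 191; in the homogeneous case Lemma 5 is not needed).

## References
* P. L. Cijsouw, M. Waldschmidt, *Linear forms and simultaneous approximations*, Compositio Math.
  34 (1977), 173–197, §4.
* A. Baker, *Transcendental Number Theory*, Cambridge University Press, 1975, Ch. 3.
-/


noncomputable section

open Complex Finset Polynomial
open Literature.NumberTheory.Transcendental.Baker1975
open Literature.NumberTheory.Transcendental.Baker1975.Ch3

namespace Literature.NumberTheory.Transcendental.CW77

/-! ### Recentring the derivative polynomials -/

/-- **Recentring** (p. 191: "`μⱼ + μₙβⱼ = (1/p){λⱼ⁰ + μⱼp + (λₙ⁰ + μₙp)βⱼ − (λⱼ⁰ + λₙ⁰βⱼ)}` … so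
that each number `φ_{J+1,(τ)}(s)` can be written as a linear combination of the numbers
`ξ_{J+1,(τ')}(s)`"): if `∑_v W(v) ∏ⱼ (gⱼ(v) + cⱼ)^{τⱼ} = 0` for all `τ` with `|τ| < N`, then
`∑_v W(v) ∏ⱼ gⱼ(v)^{τⱼ} = 0` for all `τ` with `|τ| < N` (expand `gⱼ^{τⱼ} = ((gⱼ + cⱼ) − cⱼ)^{τⱼ}`;
every multi-index `κ ≤ τ` has `|κ| ≤ |τ|`). [cite: CijsouwWaldschmidt1977, §4 (p. 191)] -/
theorem sum_mul_prod_pow_eq_zero_of_shift {V : Type*} (s : Finset V) {d : ℕ} (W : V → ℚ)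
    (g : V → Fin d → ℚ) (c : Fin d → ℚ) (N : ℕ)
    (h : ∀ τ : Fin d → ℕ, ∑ j, τ j < N → ∑ v ∈ s, W v * ∏ j, (g v j + c j) ^ τ j = 0)
    (τ : Fin d → ℕ) (hτ : ∑ j, τ j < N) : ∑ v ∈ s, W v * ∏ j, (g v j) ^ τ j = 0 := by
  classical
  -- expand `g^τ = ((g + c) + (−c))^τ` coordinatewise and take the product of the sums
  have hexp : ∀ v, ∏ j, (g v j) ^ τ j =
      ∑ κ ∈ Fintype.piFinset (fun j => range (τ j + 1)),
        ∏ j, ((g v j + c j) ^ κ j * (-c j) ^ (τ j - κ j) * ((τ j).choose (κ j) : ℚ)) := by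
    intro v
    rw [← Finset.prod_univ_sum (fun j => range (τ j + 1))
      (fun j k => (g v j + c j) ^ k * (-c j) ^ (τ j - k) * ((τ j).choose k : ℚ))]
    refine prod_congr rfl fun j _ => ?_
    have : g v j = (g v j + c j) + (-c j) := by ring
    conv_lhs => rw [this]
    rw [add_pow]
  simp_rw [hexp, mul_sum]
  rw [sum_comm]
  refine sum_eq_zero fun κ hκ => ?_
  have hκle : ∀ j, κ j ≤ τ j := fun j => by
    have := Fintype.mem_piFinset.mp hκ j
    exact Nat.lt_succ_iff.mp (mem_range.mp this)
  have hκN : ∑ j, κ j < N := lt_of_le_of_lt (sum_le_sum fun j _ => hκle j) hτ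
  -- pull the constants out
  have hsplit : ∀ v, W v * ∏ j, ((g v j + c j) ^ κ j * (-c j) ^ (τ j - κ j) * ((τ j).choose (κ j) : ℚ)) =
      (∏ j, ((-c j) ^ (τ j - κ j) * ((τ j).choose (κ j) : ℚ))) * (W v * ∏ j, (g v j + c j) ^ κ j) := by
    intro v
    rw [show (∏ j, ((g v j + c j) ^ κ j * (-c j) ^ (τ j - κ j) * ((τ j).choose (κ j) : ℚ))) =
        (∏ j, (g v j + c j) ^ κ j) * ∏ j, ((-c j) ^ (τ j - κ j) * ((τ j).choose (κ j) : ℚ)) by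
      rw [← prod_mul_distrib]; refine prod_congr rfl fun j _ => ?_; ring]
    ring
  simp_rw [hsplit]
  rw [← mul_sum, h κ hκN, mul_zero]

/-! ### Square roots: parities -/

/-- `(√a)ⁿ = a^{⌊n/2⌋} · (√a)^{n mod 2}` for `a ≥ 0`. [folklore] -/
theorem sqrt_pow_eq {a : ℝ} (ha : 0 ≤ a) (n : ℕ) :
    Real.sqrt a ^ n = a ^ (n / 2) * Real.sqrt a ^ (n % 2) := by
  conv_lhs => rw [← Nat.div_add_mod n 2]
  rw [pow_add, pow_mul, Real.sq_sqrt ha]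

/-- `(√a)^{n mod 2} = √a` or `1` according to the parity. [folklore] -/
theorem sqrt_pow_mod_two (a : ℝ) (n : ℕ) :
    Real.sqrt a ^ (n % 2) = if n % 2 = 1 then Real.sqrt a else 1 := by
  rcases Nat.mod_two_eq_zero_or_one n with h | h
  · rw [h]; simp
  · rw [h]; simp

namespace Setup

variable (S : Setup) {h Lb : ℕ}

/-- All `d + 1` generators: `αⱼ` (`j < d`) and `θ` (last). [cite: CijsouwWaldschmidt1977, Prop 1 (p. 183)] -/
def all : Fin (S.d + 1) → ℚ := Fin.snoc S.α S.θ

/-- All generators are positive. [folklore] -/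
theorem all_pos (i : Fin (S.d + 1)) : 0 < S.all i := by
  unfold all
  refine Fin.lastCases ?_ (fun j => ?_) i
  · rw [Fin.snoc_last]; exact S.θ_pos
  · rw [Fin.snoc_castSucc]; exact S.α_pos j

/-- The exponents `λⱼ s` (`j < d`), `λ_θ s` (last) of one unknown at the point `s`. [folklore] -/
def expn (u : Idx S.d h Lb) (s : ℕ) : Fin (S.d + 1) → ℕ := Fin.snoc (fun j => u.2.1 j * s) (u.2.2 * s)

/-- `ψ_u · s = ∑ᵢ expn(u,s)ᵢ · log(allᵢ)`. [folklore] -/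
theorem ψ_mul_natCast (u : Idx S.d h Lb) (s : ℕ) :
    S.ψ u * s = ∑ i : Fin (S.d + 1), (S.expn u s i : ℝ) * Real.log (S.all i) := by
  unfold ψ expn all l lθ
  rw [Fin.sum_univ_castSucc]
  simp only [Fin.snoc_castSucc, Fin.snoc_last]
  push_cast
  rw [add_mul, sum_mul]
  congr 1
  · exact sum_congr rfl fun j _ => by ring
  · ring

/-- The parity class of one unknown at the point `s`: the set of generators with an odd exponent.
[cite: CijsouwWaldschmidt1977, §4 (p. 189)] -/
def Sset (u : Idx S.d h Lb) (s : ℕ) : Finset (Fin (S.d + 1)) :=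
  univ.filter fun i => S.expn u s i % 2 = 1

/-- The rational part of `e^{ψ_u s/2}`: `qEh = ∏ᵢ allᵢ^{⌊expnᵢ/2⌋}`. [cite: CijsouwWaldschmidt1977, §4 (p. 189)] -/
def qEh (u : Idx S.d h Lb) (s : ℕ) : ℚ := ∏ i, (S.all i) ^ (S.expn u s i / 2)

/-- **`e^{ψ_u s/2} = qEh · ∏_{i ∈ Sset} √allᵢ`.** [cite: CijsouwWaldschmidt1977, §4 (p. 189)] -/
theorem cexp_ψ_half (u : Idx S.d h Lb) (s : ℕ) :
    cexp ((S.ψ u : ℂ) * ((s : ℂ) / 2)) = ((S.qEh u s : ℝ) * mono S.all (S.Sset u s) : ℝ) := by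
  have hreal : (S.ψ u : ℂ) * ((s : ℂ) / 2) = ((S.ψ u * s / 2 : ℝ) : ℂ) := by push_cast; ring
  rw [hreal, ← Complex.ofReal_exp]
  congr 1
  rw [S.ψ_mul_natCast, Finset.sum_div, Real.exp_sum]
  have hterm : ∀ i, Real.exp ((S.expn u s i : ℝ) * Real.log (S.all i) / 2) =
      Real.sqrt (S.all i) ^ S.expn u s i := by
    intro i
    have hpos : (0 : ℝ) < S.all i := by exact_mod_cast S.all_pos i
    rw [show ((S.expn u s i : ℝ) * Real.log (S.all i) / 2) = (S.expn u s i : ℝ) * (Real.log (S.all i) / 2)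
      by ring, Real.exp_nat_mul]
    congr 1
    rw [Real.sqrt_eq_rpow, Real.rpow_def_of_pos hpos]
    congr 1; ring
  simp_rw [hterm]
  unfold qEh mono
  push_cast
  have h0 : ∀ i, (0 : ℝ) ≤ (S.all i : ℝ) := fun i => by exact_mod_cast (S.all_pos i).le
  have hterm2 : ∀ i, Real.sqrt (S.all i) ^ S.expn u s i =
      ((S.all i : ℝ)) ^ (S.expn u s i / 2) * (if S.expn u s i % 2 = 1 then Real.sqrt (S.all i) else 1) :=
    fun i => by rw [sqrt_pow_eq (h0 i), sqrt_pow_mod_two]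
  rw [prod_congr rfl (fun i _ => hterm2 i), prod_mul_distrib]
  congr 1
  unfold Sset
  rw [Finset.prod_filter]

/-- **The `Δ`-factor at the half-integers**: for `J < J₀`,
`Qw τ₀ (w_ρ(2^{J₀−J}X)) 0 (s/2) = 2^{τ₀} · qΔ_{J+1}(s)` (the same natural point `2^{J₀−J−1}s`).
[cite: CijsouwWaldschmidt1977, §4 (p. 189)] -/
theorem Qw_wOf_half {J₀ J : ℕ} (hJ : J < J₀) (u : Idx S.d h Lb) (τ₀ s : ℕ) :
    Qw τ₀ (S.wOf J₀ J u) 0 ((s : ℂ) / 2) = (2 : ℂ) ^ τ₀ * (S.qΔ J₀ (J + 1) u τ₀ s : ℂ) := by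
  rw [Qw_zero_right, iterate_derivative_eval_eq_factorial_mul_hasseDeriv]
  unfold wOf qΔ scale
  rw [hasseDeriv_comp_C_mul_X_eval]
  have hJJ : J₀ - J = (J₀ - (J + 1)) + 1 := by omega
  have hpt : (((2 ^ (J₀ - J) : ℕ)) : ℂ) * ((s : ℂ) / 2) = (((2 ^ (J₀ - (J + 1)) * s : ℕ)) : ℂ) := by
    rw [hJJ, pow_succ]; push_cast; ring
  rw [hpt]
  have hspec := (hdNat_spec (b := (u.1.2 : ℕ)) (le_of_lt u.1.1.isLt) (2 ^ (J₀ - (J + 1)) * s) τ₀).1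
  have hν : ((nuBound (2 ^ (J₀ - (J + 1)) * s) h : ℂ)) ^ τ₀ ≠ 0 :=
    pow_ne_zero _ (by exact_mod_cast (nuBound_pos _ _).ne')
  have hH : (hasseDeriv τ₀ (wPoly (u.1.1 : ℕ) (u.1.2 : ℕ) h)).eval ((((2 ^ (J₀ - (J + 1)) * s : ℕ)) : ℂ)) =
      (hdNat (b := (u.1.2 : ℕ)) (le_of_lt u.1.1.isLt) (2 ^ (J₀ - (J + 1)) * s) τ₀ : ℂ) /
        ((nuBound (2 ^ (J₀ - (J + 1)) * s) h : ℂ)) ^ τ₀ := by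
    rw [eq_div_iff hν, mul_comm, ← hspec]
  rw [hH, hJJ, pow_succ]
  push_cast
  ring

/-- The rational coefficient of one unknown in `φ_{J,τ}(s/2)`: `rHalf = qΔ_{J+1} · qA · qEh`.
[cite: CijsouwWaldschmidt1977, §4 (p. 189)] -/
def rHalf (J₀ J : ℕ) (u : Idx S.d h Lb) (τ : Tau S.d) (s : ℕ) : ℚ :=
  S.qΔ J₀ (J + 1) u τ.1 s * S.qA u τ.2 * S.qEh u s

/-- **One term of `φ_{J,τ}` at `s/2`**: `termΦ(s/2) = 2^{τ₀} · rHalf · ∏_{i∈Sset} √allᵢ`.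
[cite: CijsouwWaldschmidt1977, §4 (p. 189)] -/
theorem termΦ_half {J₀ J : ℕ} (hJ : J < J₀) (u : Idx S.d h Lb) (τ : Tau S.d) (s : ℕ) :
    S.termΦ J₀ J u τ ((s : ℂ) / 2) =
      (2 : ℂ) ^ τ.1 * (((S.rHalf J₀ J u τ s : ℝ) * mono S.all (S.Sset u s) : ℝ) : ℂ) := by
  unfold termΦ rHalf
  rw [S.Qw_wOf_half hJ, S.A_eq, S.cexp_ψ_half]
  push_cast; ring

/-- **The class sums**: the rational coefficient of the monomial `∏_{i∈T} √allᵢ` in `φ_{J,τ}(s/2)`.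
[cite: CijsouwWaldschmidt1977, §4 (p. 189)] -/
def classVec (J₀ J : ℕ) (box : Finset (Idx S.d h Lb)) (p : Idx S.d h Lb → ℤ) (τ : Tau S.d) (s : ℕ)
    (T : Finset (Fin (S.d + 1))) : ℚ :=
  ∑ u ∈ box with S.Sset u s = T, (p u : ℚ) * S.rHalf J₀ J u τ s

/-- **`φ_{J,τ}(s/2) = 2^{τ₀} · ev(classVec)`** — "we can express `φ_{J,(τ)}(s/p)` on the basis
`{α₁^{l₁/p}⋯αₙ^{lₙ/p}}` … the coefficients in this expression consist of those contributions of `∑_λ`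
for which `λⱼ ≡ λⱼ⁰ (mod p)`" (p. 189). [cite: CijsouwWaldschmidt1977, §4 (p. 189)] -/
theorem Φ_half {J₀ J : ℕ} (hJ : J < J₀) (box : Finset (Idx S.d h Lb)) (p : Idx S.d h Lb → ℤ)
    (τ : Tau S.d) (s : ℕ) :
    S.Φ J₀ J box p τ ((s : ℂ) / 2) =
      (2 : ℂ) ^ τ.1 * (ev S.all (S.classVec J₀ J box p τ s) : ℂ) := by
  classical
  unfold Φ ev classVec
  have hfib : ∑ u ∈ box, (p u : ℂ) * S.termΦ J₀ J u τ ((s : ℂ) / 2) =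
      (2 : ℂ) ^ τ.1 *
        ((∑ u ∈ box, ((p u : ℚ) * S.rHalf J₀ J u τ s : ℝ) * mono S.all (S.Sset u s) : ℝ) : ℂ) := by
    push_cast
    rw [mul_sum]
    refine sum_congr rfl fun u _ => ?_
    rw [S.termΦ_half hJ]; push_cast; ring
  rw [hfib]
  congr 2
  rw [← Finset.sum_fiberwise box (fun u => S.Sset u s)
    (fun u => ((p u : ℚ) * S.rHalf J₀ J u τ s : ℝ) * mono S.all (S.Sset u s))]
  refine sum_congr rfl fun T _ => ?_
  rw [Rat.cast_sum, sum_mul]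
  refine sum_congr rfl fun u hu => ?_
  rw [(Finset.mem_filter.mp hu).2]; push_cast; ring

/-- **Independence of the square classes ⇒ every class sum vanishes** ("Since each of these
coefficients must be zero", p. 189). [cite: CijsouwWaldschmidt1977, §4 (p. 189)] -/
theorem classVec_eq_zero (hind : ∀ T : Finset (Fin (S.d + 1)), T.Nonempty → ¬ IsSquare (∏ i ∈ T, S.all i))
    {J₀ J : ℕ} (hJ : J < J₀) (box : Finset (Idx S.d h Lb))
    (p : Idx S.d h Lb → ℤ) (τ : Tau S.d) (s : ℕ) (h0 : S.Φ J₀ J box p τ ((s : ℂ) / 2) = 0) :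
    S.classVec J₀ J box p τ s = 0 := by
  by_contra hne
  have hev := ev_ne_zero S.all (fun i => (S.all_pos i).le) hind hne
  rw [S.Φ_half hJ] at h0
  rcases mul_eq_zero.mp h0 with h1 | h1
  · exact absurd h1 (pow_ne_zero _ two_ne_zero)
  · exact hev (by exact_mod_cast h1)

end Setup

end Literature.NumberTheory.Transcendental.CW77

end

noncomputable section

open Complex Finset Polynomial
open Literature.NumberTheory.Transcendental.Baker1975
open Literature.NumberTheory.Transcendental.Baker1975.Ch3

namespace Literature.NumberTheory.Transcendental.CW77

namespace Setup

variable (S : Setup) {h Lb : ℕ}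

/-! ### Boxes -/

/-- The box of level `J`: all `ρ`, `λⱼ ≤ Lⱼ/2^J`, `λ_θ ≤ L_θ/2^J` (`L_j^{(J)} ≤ p^{−J} L_j`, p. 186).
[cite: CijsouwWaldschmidt1977, §4 Step 2 (p. 186)] -/
def box (L : Fin S.d → ℕ) (Lθ J : ℕ) : Finset (Idx S.d h Lb) :=
  univ ×ˢ ((Fintype.piFinset fun j => range (L j / 2 ^ J + 1)) ×ˢ range (Lθ / 2 ^ J + 1))

/-- Membership in the box. [folklore] -/
theorem mem_box {L : Fin S.d → ℕ} {Lθ J : ℕ} {u : Idx S.d h Lb} :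
    u ∈ S.box (h := h) (Lb := Lb) L Lθ J ↔ (∀ j, u.2.1 j ≤ L j / 2 ^ J) ∧ u.2.2 ≤ Lθ / 2 ^ J := by
  unfold box
  simp only [mem_product, mem_univ, true_and, Fintype.mem_piFinset, mem_range, Nat.lt_succ_iff]

/-! ### Re-indexing `λ = λ⁰ + 2μ` -/

/-- The re-indexing map `μ ↦ λ⁰ + 2μ` (`ρ` unchanged). [cite: CijsouwWaldschmidt1977, §4 (p. 190)] -/
def reidx (ε : Fin S.d → ℕ) (εθ : ℕ) (v : Idx S.d h Lb) : Idx S.d h Lb :=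
  (v.1, (fun j => ε j + 2 * v.2.1 j, εθ + 2 * v.2.2))

/-- The halving map `λ ↦ ⌊λ/2⌋`. [folklore] -/
def halve (u : Idx S.d h Lb) : Idx S.d h Lb := (u.1, (fun j => u.2.1 j / 2, u.2.2 / 2))

/-- `halve (reidx v) = v` for residues `≤ 1`. [folklore] -/
theorem halve_reidx {ε : Fin S.d → ℕ} {εθ : ℕ} (hε : ∀ j, ε j ≤ 1) (hεθ : εθ ≤ 1) (v : Idx S.d h Lb) :
    S.halve (S.reidx ε εθ v) = v := by
  unfold halve reidx
  rcases v with ⟨ρ, μ, μθ⟩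
  simp only [Prod.mk.injEq, true_and]
  refine ⟨funext fun j => ?_, ?_⟩
  · have := hε j; omega
  · omega

/-- `reidx (halve u) = u` when `u` has the residues `ε`. [folklore] -/
theorem reidx_halve {ε : Fin S.d → ℕ} {εθ : ℕ} (u : Idx S.d h Lb) (hu : ∀ j, u.2.1 j % 2 = ε j)
    (huθ : u.2.2 % 2 = εθ) : S.reidx ε εθ (S.halve u) = u := by
  unfold halve reidx
  rcases u with ⟨ρ, lam, lamθ⟩
  dsimp only at hu huθ ⊢
  simp only [Prod.mk.injEq, true_and]
  refine ⟨funext fun j => ?_, ?_⟩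
  · have := hu j; have := Nat.div_add_mod (lam j) 2; omega
  · have := Nat.div_add_mod lamθ 2; omega

/-- `reidx` is injective. [folklore] -/
theorem reidx_injective (ε : Fin S.d → ℕ) (εθ : ℕ) : Function.Injective (S.reidx (h := h) (Lb := Lb) ε εθ) := by
  intro v w hvw
  unfold reidx at hvw
  rcases v with ⟨ρ, μ, μθ⟩
  rcases w with ⟨ρ', μ', μθ'⟩
  simp only [Prod.mk.injEq] at hvw
  obtain ⟨hρ, hμ, hμθ⟩ := hvw
  simp only [Prod.mk.injEq]
  refine ⟨hρ, funext fun j => ?_, by omega⟩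
  have := congrFun hμ j; omega

/-- `reidx v ∈ box_J ⇒ v ∈ box_{J+1}` (`⌊(L/2^J)/2⌋ = L/2^{J+1}`). [cite: CijsouwWaldschmidt1977, §4 (p. 190)] -/
theorem mem_box_succ_of_reidx {L : Fin S.d → ℕ} {Lθ J : ℕ} {ε : Fin S.d → ℕ} {εθ : ℕ} {v : Idx S.d h Lb}
    (hv : S.reidx ε εθ v ∈ S.box (h := h) (Lb := Lb) L Lθ J) : v ∈ S.box (h := h) (Lb := Lb) L Lθ (J + 1) := by
  rw [S.mem_box] at hv ⊢
  unfold reidx at hv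
  simp only at hv
  have hdiv : ∀ L' : ℕ, L' / 2 ^ J / 2 = L' / 2 ^ (J + 1) := fun L' => by
    rw [Nat.div_div_eq_div_mul, pow_succ]
  refine ⟨fun j => ?_, ?_⟩
  · have := hv.1 j; rw [← hdiv]; omega
  · have := hv.2; rw [← hdiv]; omega

/-- `halve u ∈ box_{J+1}` for `u ∈ box_J`. [folklore] -/
theorem halve_mem_box_succ {L : Fin S.d → ℕ} {Lθ J : ℕ} {u : Idx S.d h Lb}
    (hu : u ∈ S.box (h := h) (Lb := Lb) L Lθ J) : S.halve u ∈ S.box (h := h) (Lb := Lb) L Lθ (J + 1) := by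
  rw [S.mem_box] at hu ⊢
  unfold halve
  simp only
  have hdiv : ∀ L' : ℕ, L' / 2 ^ J / 2 = L' / 2 ^ (J + 1) := fun L' => by
    rw [Nat.div_div_eq_div_mul, pow_succ]
  exact ⟨fun j => by rw [← hdiv]; exact Nat.div_le_div_right (hu.1 j),
    by rw [← hdiv]; exact Nat.div_le_div_right hu.2⟩

/-! ### Parities at an odd point -/

/-- The residue vector `(ε, εθ)` on all `d + 1` generators. [folklore] -/
def resVec (ε : Fin S.d → ℕ) (εθ : ℕ) : Fin (S.d + 1) → ℕ := Fin.snoc ε εθ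

/-- Components of `resVec`. [folklore] -/
@[simp] theorem resVec_castSucc (ε : Fin S.d → ℕ) (εθ : ℕ) (j : Fin S.d) :
    S.resVec ε εθ (Fin.castSucc j) = ε j := by unfold resVec; rw [Fin.snoc_castSucc]

/-- Components of `resVec`. [folklore] -/
@[simp] theorem resVec_last (ε : Fin S.d → ℕ) (εθ : ℕ) : S.resVec ε εθ (Fin.last S.d) = εθ := by
  unfold resVec; rw [Fin.snoc_last]

/-- Components of `expn`. [folklore] -/
@[simp] theorem expn_castSucc (u : Idx S.d h Lb) (s : ℕ) (j : Fin S.d) :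
    S.expn u s (Fin.castSucc j) = u.2.1 j * s := by unfold expn; rw [Fin.snoc_castSucc]

/-- Components of `expn`. [folklore] -/
@[simp] theorem expn_last (u : Idx S.d h Lb) (s : ℕ) : S.expn u s (Fin.last S.d) = u.2.2 * s := by
  unfold expn; rw [Fin.snoc_last]

/-- The parity pattern of the residues: `Tpat = {i : (resVec ε εθ)ᵢ odd}`. [folklore] -/
def Tpat (ε : Fin S.d → ℕ) (εθ : ℕ) : Finset (Fin (S.d + 1)) :=
  univ.filter fun i => S.resVec ε εθ i % 2 = 1

/-- For odd `s`: `(n s) mod 2 = n mod 2`. [folklore] -/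
theorem mul_odd_mod_two {s : ℕ} (hs : Odd s) (n : ℕ) : n * s % 2 = n % 2 := by
  obtain ⟨k, rfl⟩ := hs
  rw [Nat.mul_mod, show (2 * k + 1) % 2 = 1 by omega, mul_one, Nat.mod_mod]

/-- For odd `s`, the parity class of `u` is the pattern of `u`'s residues: `Sset u s = Tpat ε εθ` iff
`λⱼ ≡ εⱼ`, `λ_θ ≡ εθ (mod 2)`. [cite: CijsouwWaldschmidt1977, §4 (p. 189)] -/
theorem Sset_eq_Tpat_iff {s : ℕ} (hs : Odd s) {ε : Fin S.d → ℕ} {εθ : ℕ} (hε : ∀ j, ε j ≤ 1) (hεθ : εθ ≤ 1)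
    (u : Idx S.d h Lb) :
    S.Sset u s = S.Tpat ε εθ ↔ (∀ j, u.2.1 j % 2 = ε j) ∧ u.2.2 % 2 = εθ := by
  unfold Sset Tpat
  constructor
  · intro heq
    have key : ∀ i : Fin (S.d + 1), S.expn u s i % 2 = 1 ↔ S.resVec ε εθ i % 2 = 1 := by
      intro i
      have h1 := Finset.ext_iff.mp heq i
      simpa using h1
    refine ⟨fun j => ?_, ?_⟩
    · have h1 := key (Fin.castSucc j)
      rw [S.expn_castSucc, S.resVec_castSucc, mul_odd_mod_two hs] at h1
      have := hε j; omega
    · have h1 := key (Fin.last S.d)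
      rw [S.expn_last, S.resVec_last, mul_odd_mod_two hs] at h1
      omega
  · rintro ⟨hj, hθ⟩
    ext i
    simp only [mem_filter, mem_univ, true_and]
    refine Fin.lastCases ?_ (fun j => ?_) i
    · rw [S.expn_last, S.resVec_last, mul_odd_mod_two hs, hθ]; omega
    · rw [S.expn_castSucc, S.resVec_castSucc, mul_odd_mod_two hs, hj j]; have := hε j; omega

/-- The residues of `reidx ε εθ v` are `ε, εθ`. [folklore] -/
theorem reidx_mod_two {ε : Fin S.d → ℕ} {εθ : ℕ} (hε : ∀ j, ε j ≤ 1) (hεθ : εθ ≤ 1) (v : Idx S.d h Lb) :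
    (∀ j, (S.reidx ε εθ v).2.1 j % 2 = ε j) ∧ (S.reidx ε εθ v).2.2 % 2 = εθ := by
  unfold reidx
  simp only
  exact ⟨fun j => by have := hε j; omega, by omega⟩

/-! ### The effect of the re-indexing on the rational coefficients -/

/-- `qΔ` depends on `u` only through `ρ`. [folklore] -/
theorem qΔ_reidx (J₀ J' : ℕ) (ε : Fin S.d → ℕ) (εθ : ℕ) (v : Idx S.d h Lb) (τ₀ s : ℕ) :
    S.qΔ J₀ J' (S.reidx ε εθ v) τ₀ s = S.qΔ J₀ J' v τ₀ s := rfl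

/-- The constant factor `K = ∏ᵢ allᵢ^{⌊εᵢ s/2⌋}` pulled out of `qEh`. [folklore] -/
def Kfac (ε : Fin S.d → ℕ) (εθ s : ℕ) : ℚ := ∏ i : Fin (S.d + 1), S.all i ^ (S.resVec ε εθ i * s / 2)

/-- `Kfac > 0`. [folklore] -/
theorem Kfac_pos (ε : Fin S.d → ℕ) (εθ s : ℕ) : 0 < S.Kfac ε εθ s := by
  unfold Kfac; exact prod_pos fun i _ => pow_pos (S.all_pos i) _

/-- **`qEh(reidx v, s) = Kfac · qE(v, s)`** (`((ε + 2μ)s)/2 = (εs)/2 + μs`). [cite: CijsouwWaldschmidt1977, §4 (p. 190)] -/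
theorem qEh_reidx (ε : Fin S.d → ℕ) (εθ : ℕ) (v : Idx S.d h Lb) (s : ℕ) :
    S.qEh (S.reidx ε εθ v) s = S.Kfac ε εθ s * S.qE v s := by
  unfold qEh Kfac qE
  rw [Fin.prod_univ_castSucc, Fin.prod_univ_castSucc]
  simp only [expn_castSucc, expn_last, resVec_castSucc, resVec_last]
  unfold reidx all
  simp only [Fin.snoc_castSucc, Fin.snoc_last]
  have hsplit : ∀ (a : ℚ) (e m : ℕ), a ^ ((e + 2 * m) * s / 2) = a ^ (e * s / 2) * a ^ (m * s) := by
    intro a e m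
    rw [← pow_add]; congr 1
    rw [show (e + 2 * m) * s = e * s + 2 * (m * s) by ring, Nat.add_mul_div_left _ _ two_pos]
  simp_rw [hsplit]
  rw [prod_mul_distrib]
  ring

/-- The recentring constants `cⱼ = (εⱼ + εθ βⱼ)/2`. [cite: CijsouwWaldschmidt1977, §4 (p. 191)] -/
def cγ (ε : Fin S.d → ℕ) (εθ : ℕ) (j : Fin S.d) : ℚ := ((ε j : ℚ) + (εθ : ℚ) * S.β j) / 2

/-- **`γⱼ(λ⁰ + 2μ) = 2(γⱼ(μ) + cⱼ)`.** [cite: CijsouwWaldschmidt1977, §4 (p. 191)] -/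
theorem γ_reidx (ε : Fin S.d → ℕ) (εθ : ℕ) (v : Idx S.d h Lb) (j : Fin S.d) :
    S.γ (S.reidx ε εθ v) j = 2 * (S.γ v j + S.cγ ε εθ j) := by
  unfold γ reidx cγ
  simp only; push_cast; ring

/-- `qA(reidx v, τ') = 2^{|τ'|} ∏ⱼ (γⱼ(v) + cⱼ)^{τ'ⱼ}`. [cite: CijsouwWaldschmidt1977, §4 (p. 191)] -/
theorem qA_reidx (ε : Fin S.d → ℕ) (εθ : ℕ) (v : Idx S.d h Lb) (τ' : Fin S.d → ℕ) :
    S.qA (S.reidx ε εθ v) τ' = 2 ^ (∑ j, τ' j) * ∏ j, (S.γ v j + S.cγ ε εθ j) ^ τ' j := by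
  unfold qA
  simp_rw [S.γ_reidx, mul_pow]
  rw [prod_mul_distrib, Finset.prod_pow_eq_pow_sum]

/-- **`rHalf(reidx v) = (2^{|τ'|} Kfac) · qΔ_{J+1}(v) qE(v) · ∏ (γⱼ(v) + cⱼ)^{τ'ⱼ}`.**
[cite: CijsouwWaldschmidt1977, §4 (pp. 190–191)] -/
theorem rHalf_reidx (J₀ J : ℕ) (ε : Fin S.d → ℕ) (εθ : ℕ) (v : Idx S.d h Lb) (τ : Tau S.d) (s : ℕ) :
    S.rHalf J₀ J (S.reidx ε εθ v) τ s =
      (2 ^ (∑ j, τ.2 j) * S.Kfac ε εθ s) *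
        ((S.qΔ J₀ (J + 1) v τ.1 s * S.qE v s) * ∏ j, (S.γ v j + S.cγ ε εθ j) ^ τ.2 j) := by
  unfold rHalf
  rw [S.qΔ_reidx, S.qEh_reidx, S.qA_reidx]
  ring

end Setup

end Literature.NumberTheory.Transcendental.CW77

end

noncomputable section

open Complex Finset Polynomial
open Literature.NumberTheory.Transcendental.Baker1975
open Literature.NumberTheory.Transcendental.Baker1975.Ch3

namespace Literature.NumberTheory.Transcendental.CW77

namespace Setup

variable (S : Setup) {h Lb : ℕ}

/-- **Summing over a residue class = summing over the re-indexed box** (odd `s`).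
[cite: CijsouwWaldschmidt1977, §4 (p. 190)] -/
theorem sum_class_eq_sum_reidx {s : ℕ} (hs : Odd s) {ε : Fin S.d → ℕ} {εθ : ℕ} (hε : ∀ j, ε j ≤ 1)
    (hεθ : εθ ≤ 1) (L : Fin S.d → ℕ) (Lθ J : ℕ) (G : Idx S.d h Lb → ℚ) :
    ∑ u ∈ S.box (h := h) (Lb := Lb) L Lθ J with S.Sset u s = S.Tpat ε εθ, G u =
      ∑ v ∈ S.box (h := h) (Lb := Lb) L Lθ (J + 1) with S.reidx ε εθ v ∈ S.box (h := h) (Lb := Lb) L Lθ J,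
        G (S.reidx ε εθ v) := by
  refine Finset.sum_nbij' (S.halve) (S.reidx ε εθ) ?_ ?_ ?_ ?_ ?_
  · intro u hu
    rw [mem_filter] at hu ⊢
    obtain ⟨hub, hus⟩ := hu
    have hpar := (S.Sset_eq_Tpat_iff hs hε hεθ u).mp hus
    refine ⟨S.halve_mem_box_succ hub, ?_⟩
    rw [S.reidx_halve u hpar.1 hpar.2]; exact hub
  · intro v hv
    rw [mem_filter] at hv ⊢
    refine ⟨hv.2, ?_⟩
    exact (S.Sset_eq_Tpat_iff hs hε hεθ _).mpr (S.reidx_mod_two hε hεθ v)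
  · intro u hu
    rw [mem_filter] at hu
    have hpar := (S.Sset_eq_Tpat_iff hs hε hεθ u).mp hu.2
    exact S.reidx_halve u hpar.1 hpar.2
  · intro v _
    exact S.halve_reidx hε hεθ v
  · intro u hu
    rw [mem_filter] at hu
    have hpar := (S.Sset_eq_Tpat_iff hs hε hεθ u).mp hu.2
    rw [S.reidx_halve u hpar.1 hpar.2]

/-- **The induction invariant of Step 2 at level `J`** (p. 186): integers `p(u)`, supported in the box
of level `J`, not all zero, bounded by `P`, with the relations `coreSum_{J,τ}(s) = 0` (i.e.
`φ_{J,(τ)}(s) = 0`) for all odd `s < 2^J S₀` and `|τ| < T/2^J`.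
[cite: CijsouwWaldschmidt1977, §4 Step 2 (p. 186)] -/
structure Inv (J₀ : ℕ) (L : Fin S.d → ℕ) (Lθ S₀ T : ℕ) (P : ℤ) (J : ℕ) (p : Idx S.d h Lb → ℤ) : Prop where
  /-- support in the box of level `J` -/
  supp : ∀ u, p u ≠ 0 → u ∈ S.box (h := h) (Lb := Lb) L Lθ J
  /-- not all zero -/
  nonzero : ∃ u, p u ≠ 0
  /-- the size bound -/
  bound : ∀ u, |p u| ≤ P
  /-- the relations -/
  rel : ∀ s, s < 2 ^ J * S₀ → Odd s → ∀ τ : Tau S.d, tauNorm τ < T / 2 ^ J →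
    S.coreSum J₀ J (S.box (h := h) (Lb := Lb) L Lθ J) p τ s = 0

/-- **Step 2, the algebraic half: from the vanishing of `φ_{J,τ}(s/2)` (`s` odd, `|τ| < T/2^{J+1}`) to the
invariant at level `J + 1`** ("we can express `φ_{J,(τ)}(s/p)` on the basis … Since each of these
coefficients must be zero, we have `φ⁰_{J,(τ)}(s/p) = 0` … We choose `(λ₁⁰, …, λₙ⁰)` … in such a way
that at least one of the numbers `p^{(J)}(μ₀, λ⁰ + μp)` is non-zero … `p^{(J+1)}` … so that each number
`φ_{J+1,(τ)}(s)` can be written as a linear combination of the numbers `ξ_{J+1,(τ')}(s)`; hence, they are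
zero", pp. 189–191). [cite: CijsouwWaldschmidt1977, §4 Step 2 (pp. 189–191)] -/
theorem descent_algebra (hind : ∀ T : Finset (Fin (S.d + 1)), T.Nonempty → ¬ IsSquare (∏ i ∈ T, S.all i))
    {J₀ J : ℕ} (hJ : J < J₀) {L : Fin S.d → ℕ} {Lθ S₀ T : ℕ} {P : ℤ}
    {p : Idx S.d h Lb → ℤ} (inv : S.Inv J₀ L Lθ S₀ T P J p)
    (half : ∀ s, s < 2 ^ (J + 1) * S₀ → Odd s → ∀ τ : Tau S.d, tauNorm τ < T / 2 ^ (J + 1) →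
      S.Φ J₀ J (S.box (h := h) (Lb := Lb) L Lθ J) p τ ((s : ℂ) / 2) = 0) :
    ∃ p' : Idx S.d h Lb → ℤ, S.Inv J₀ L Lθ S₀ T P (J + 1) p' := by
  classical
  obtain ⟨u₀, hu₀⟩ := inv.nonzero
  set ε : Fin S.d → ℕ := fun j => u₀.2.1 j % 2 with hεdef
  set εθ : ℕ := u₀.2.2 % 2 with hεθdef
  have hε : ∀ j, ε j ≤ 1 := fun j => by simp only [hεdef]; omega
  have hεθ : εθ ≤ 1 := by simp only [hεθdef]; omega
  set p' : Idx S.d h Lb → ℤ := fun v => p (S.reidx ε εθ v) with hp'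
  set boxJ := S.box (h := h) (Lb := Lb) L Lθ J with hboxJ
  set boxJ1 := S.box (h := h) (Lb := Lb) L Lθ (J + 1) with hboxJ1
  refine ⟨p', ⟨?_, ?_, ?_, ?_⟩⟩
  · -- support
    intro v hv
    exact S.mem_box_succ_of_reidx (inv.supp _ hv)
  · -- not all zero
    refine ⟨S.halve u₀, ?_⟩
    simp only [hp']
    rw [S.reidx_halve u₀ (fun j => rfl) rfl]
    exact hu₀
  · -- bound
    intro v; exact inv.bound _
  · -- the relations at level `J + 1`
    intro s hs hodd τ hτ
    -- all the class sums vanish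
    have hcv : ∀ τ' : Fin S.d → ℕ, τ.1 + ∑ j, τ' j < T / 2 ^ (J + 1) →
        S.classVec J₀ J boxJ p (τ.1, τ') s (S.Tpat ε εθ) = 0 := by
      intro τ' hτ'
      have h0 := half s hs hodd (τ.1, τ') (by unfold tauNorm; exact hτ')
      have := S.classVec_eq_zero hind hJ boxJ p (τ.1, τ') s h0
      exact congrFun this _
    -- the set of new unknowns coming from old ones
    set Vs := boxJ1.filter fun v => S.reidx ε εθ v ∈ boxJ with hVs
    set W : Idx S.d h Lb → ℚ := fun v => (p' v : ℚ) * (S.qΔ J₀ (J + 1) v τ.1 s * S.qE v s) with hW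
    -- the shifted relations
    have hshift : ∀ τ' : Fin S.d → ℕ, ∑ j, τ' j < T / 2 ^ (J + 1) - τ.1 →
        ∑ v ∈ Vs, W v * ∏ j, (S.γ v j + S.cγ ε εθ j) ^ τ' j = 0 := by
      intro τ' hτ'
      have h1 := hcv τ' (by omega)
      unfold classVec at h1
      rw [S.sum_class_eq_sum_reidx hodd hε hεθ L Lθ J] at h1
      -- `h1 : ∑ v ∈ Vs, p (reidx v) * rHalf (reidx v) = 0`
      simp_rw [S.rHalf_reidx] at h1
      have hK : (2 : ℚ) ^ (∑ j, τ' j) * S.Kfac ε εθ s ≠ 0 :=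
        mul_ne_zero (pow_ne_zero _ two_ne_zero) (S.Kfac_pos ε εθ s).ne'
      have h2 : ∑ v ∈ Vs, (p (S.reidx ε εθ v) : ℚ) *
          ((2 : ℚ) ^ (∑ j, τ' j) * S.Kfac ε εθ s * ((S.qΔ J₀ (J + 1) v τ.1 s * S.qE v s) *
            ∏ j, (S.γ v j + S.cγ ε εθ j) ^ τ' j)) =
          ((2 : ℚ) ^ (∑ j, τ' j) * S.Kfac ε εθ s) * ∑ v ∈ Vs, W v * ∏ j, (S.γ v j + S.cγ ε εθ j) ^ τ' j := by
        rw [mul_sum]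
        refine sum_congr rfl fun v _ => ?_
        simp only [hW, hp']; ring
      rw [h2] at h1
      exact (mul_eq_zero.mp h1).resolve_left hK
    -- recentring
    have hrel := sum_mul_prod_pow_eq_zero_of_shift Vs W (fun v j => S.γ v j) (S.cγ ε εθ) _ hshift τ.2
      (by unfold tauNorm at hτ; omega)
    -- `coreSum_{J+1} = ∑_{Vs} W ∏ γ^τ'`
    have hcore : S.coreSum J₀ (J + 1) boxJ1 p' τ s = ∑ v ∈ Vs, W v * ∏ j, S.γ v j ^ τ.2 j := by
      unfold coreSum
      rw [hVs, sum_filter]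
      refine sum_congr rfl fun v hv => ?_
      by_cases hvb : S.reidx ε εθ v ∈ boxJ
      · rw [if_pos hvb]
        unfold qTerm qA
        simp only [hW]; ring
      · rw [if_neg hvb]
        have : p' v = 0 := by
          simp only [hp']
          by_contra hne
          exact hvb (inv.supp _ hne)
        rw [this]; simp
    rw [hcore]; exact hrel

end Setup

end Literature.NumberTheory.Transcendental.CW77

end

/-!
# Cijsouw–Waldschmidt 1977 over `ℚ` (`p = 2`): Step 3, the contradiction

At the level `J₀` with `2^{J₀} > Lⱼ, L_θ` the box has `λ = 0`, so the relations `coreSum_{J₀,(0)}(s) = 0`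
say that the POLYNOMIAL `∑_ρ p(ρ,0,0) w_ρ` vanishes at every odd `s < 2^{J₀} S₀`; if these are more than
its degree (`< h · Lb`), the polynomial is zero, and since the `w_ρ = Δ(X;r)Δ(X;h)ˡ` have pairwise distinct
degrees `r + lh`, all `p(ρ,0,0) = 0` — contradicting the invariant (p. 191: "becomes a polynomial; it has
zeros for `z = s`, `0 ≤ s ≤ p^{J₀}S − 1`, `(s,p) = 1`. The number of these zeros exceeds `ST/(2p)` which is
more than the degree … But the polynomials `Δ_{λ₀}` are linearly independent; hence all `p^{(J₀)}(λ₀, 0, …, 0)`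
are zero, in contradiction to their construction").
-/

noncomputable section

open Complex Finset Polynomial
open Literature.NumberTheory.Transcendental.Baker1975
open Literature.NumberTheory.Transcendental.Baker1975.Ch3

namespace Literature.NumberTheory.Transcendental.CW77

namespace Setup

variable (S : Setup) {h Lb : ℕ}

/-- In the box of level `J₀` with `2^{J₀} > Lⱼ, L_θ` all exponents vanish. [cite: CijsouwWaldschmidt1977, §4 Step 3 (p. 191)] -/
theorem eq_zero_of_mem_box_top {L : Fin S.d → ℕ} {Lθ J₀ : ℕ} (hL : ∀ j, L j < 2 ^ J₀) (hLθ : Lθ < 2 ^ J₀)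
    {u : Idx S.d h Lb} (hu : u ∈ S.box (h := h) (Lb := Lb) L Lθ J₀) : u.2.1 = 0 ∧ u.2.2 = 0 := by
  rw [S.mem_box] at hu
  refine ⟨funext fun j => ?_, ?_⟩
  · have h1 := hu.1 j
    rw [Nat.div_eq_of_lt (hL j)] at h1
    exact Nat.le_zero.mp h1
  · have h1 := hu.2
    rw [Nat.div_eq_of_lt hLθ] at h1
    exact Nat.le_zero.mp h1

/-- `(ρ, 0, 0)` lies in every box. [folklore] -/
theorem mk_zero_mem_box (L : Fin S.d → ℕ) (Lθ J : ℕ) (ρ : Fin h × Fin Lb) :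
    ((ρ, ((0 : Fin S.d → ℕ), 0)) : Idx S.d h Lb) ∈ S.box (h := h) (Lb := Lb) L Lθ J := by
  rw [S.mem_box]; exact ⟨fun j => Nat.zero_le _, Nat.zero_le _⟩

/-- At `τ = 0`, `λ = 0`, level `J = J₀`: the rational core of one term is the VALUE of the polynomial
`w_ρ` at `s`. [cite: CijsouwWaldschmidt1977, §4 Step 3 (p. 191)] -/
theorem qTerm_top (J₀ : ℕ) (ρ : Fin h × Fin Lb) (s : ℕ) :
    ((S.qTerm J₀ J₀ ((ρ, ((0 : Fin S.d → ℕ), 0)) : Idx S.d h Lb) ((0 : ℕ), (0 : Fin S.d → ℕ)) s : ℚ) : ℂ) =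
      (wPoly (ρ.1 : ℕ) (ρ.2 : ℕ) h).eval (s : ℂ) := by
  unfold qTerm
  have hA : S.qA ((ρ, ((0 : Fin S.d → ℕ), 0)) : Idx S.d h Lb) (0 : Fin S.d → ℕ) = 1 := by
    unfold qA; simp
  have hE : S.qE ((ρ, ((0 : Fin S.d → ℕ), 0)) : Idx S.d h Lb) s = 1 := by
    unfold qE; simp
  rw [hA, hE, mul_one, mul_one]
  have hq := S.Qw_wOf_natCast J₀ J₀ ((ρ, ((0 : Fin S.d → ℕ), 0)) : Idx S.d h Lb) 0 s
  rw [← hq, Qw_zero]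
  unfold wOf
  rw [eval_comp, eval_mul, eval_C, eval_X, Nat.sub_self, pow_zero, Nat.cast_one, one_mul]

/-- Degrees of Baker's triangular family are pairwise distinct on `Fin h × Fin Lb`. [cite: BakerTNT1975, Ch. 3 §2 Lemma 2] -/
theorem natDegree_wPoly_injOn :
    Set.InjOn (fun ρ : Fin h × Fin Lb => (wPoly (ρ.1 : ℕ) (ρ.2 : ℕ) h).natDegree) (univ : Finset (Fin h × Fin Lb)) := by
  intro ρ _ ρ' _ hρ
  simp only [natDegree_wPoly] at hρ
  have h1 : (ρ.1 : ℕ) < h := ρ.1.isLt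
  have h2 : (ρ'.1 : ℕ) < h := ρ'.1.isLt
  have hb : (ρ.2 : ℕ) = ρ'.2 := by
    have key : ((ρ.1 : ℕ) + (ρ.2 : ℕ) * h) / h = ((ρ'.1 : ℕ) + (ρ'.2 : ℕ) * h) / h := by rw [hρ]
    rwa [Nat.add_mul_div_right _ _ (by omega), Nat.add_mul_div_right _ _ (by omega),
      Nat.div_eq_of_lt h1, Nat.div_eq_of_lt h2, zero_add, zero_add] at key
  have ha : (ρ.1 : ℕ) = ρ'.1 := by rw [hb] at hρ; omega
  exact Prod.ext (Fin.ext ha) (Fin.ext hb)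

/-- **Step 3 (the contradiction).** If the invariant holds at the level `J₀` with `2^{J₀} > Lⱼ, L_θ`,
`T/2^{J₀} ≥ 1` and `h · Lb ≤ ⌊2^{J₀} S₀ / 2⌋` (the number of odd points), we reach a contradiction.
[cite: CijsouwWaldschmidt1977, §4 Step 3 (p. 191)] -/
theorem endgame {J₀ : ℕ} {L : Fin S.d → ℕ} {Lθ S₀ T : ℕ} {P : ℤ} {p : Idx S.d h Lb → ℤ}
    (inv : S.Inv J₀ L Lθ S₀ T P J₀ p) (hL : ∀ j, L j < 2 ^ J₀) (hLθ : Lθ < 2 ^ J₀) (hT : 1 ≤ T / 2 ^ J₀)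
    (hcount : h * Lb ≤ 2 ^ J₀ * S₀ / 2) : False := by
  classical
  set boxJ := S.box (h := h) (Lb := Lb) L Lθ J₀ with hbox
  -- the polynomial
  set c : Fin h × Fin Lb → ℂ := fun ρ => (p ((ρ, ((0 : Fin S.d → ℕ), 0)) : Idx S.d h Lb) : ℂ) with hc
  set Pp : ℂ[X] := ∑ ρ : Fin h × Fin Lb, c ρ • wPoly (ρ.1 : ℕ) (ρ.2 : ℕ) h with hPp
  -- its values at odd `s < 2^{J₀} S₀` vanish
  have heval : ∀ s : ℕ, s < 2 ^ J₀ * S₀ → Odd s → Pp.eval (s : ℂ) = 0 := by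
    intro s hs hodd
    have h00 : tauNorm (((0 : ℕ), (0 : Fin S.d → ℕ)) : Tau S.d) = 0 := by unfold tauNorm; simp
    have hrel := inv.rel s hs hodd (0, 0) (by rw [h00]; exact hT)
    -- `coreSum = ∑_ρ p(ρ,0,0) · w_ρ(s)`
    have hsum : ((S.coreSum J₀ J₀ boxJ p ((0 : ℕ), (0 : Fin S.d → ℕ)) s : ℚ) : ℂ) = Pp.eval (s : ℂ) := by
      unfold coreSum
      rw [hPp, eval_finsetSum]
      push_cast
      -- reindex the box by `ρ`
      symm
      refine Finset.sum_nbij' (fun ρ => ((ρ, ((0 : Fin S.d → ℕ), 0)) : Idx S.d h Lb)) (fun u => u.1) ?_ ?_ ?_ ?_ ?_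
      · intro ρ _; exact S.mk_zero_mem_box L Lθ J₀ ρ
      · intro u _; exact mem_univ _
      · intro ρ _; rfl
      · intro u hu
        obtain ⟨h1, h2⟩ := S.eq_zero_of_mem_box_top hL hLθ hu
        rcases u with ⟨ρ, lam, lamθ⟩
        simp only at h1 h2 ⊢
        rw [h1, h2]
      · intro ρ _
        rw [eval_smul, smul_eq_mul, hc, S.qTerm_top]
    rw [← hsum, hrel]; simp
  -- degree bound
  have hdeg : Pp.natDegree < h * Lb ∨ h * Lb = 0 := by
    rcases Nat.eq_zero_or_pos (h * Lb) with h0 | hpos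
    · exact Or.inr h0
    · left
      have hle : Pp.natDegree ≤ h * Lb - 1 := by
        rw [hPp]
        refine (natDegree_sum_le_of_forall_le _ _ fun ρ _ => ?_)
        calc (c ρ • wPoly (ρ.1 : ℕ) (ρ.2 : ℕ) h).natDegree ≤ (wPoly (ρ.1 : ℕ) (ρ.2 : ℕ) h).natDegree :=
              natDegree_smul_le _ _
          _ = (ρ.1 : ℕ) + (ρ.2 : ℕ) * h := natDegree_wPoly _ _ _
          _ ≤ h * Lb - 1 := by
              have h1 : (ρ.1 : ℕ) < h := ρ.1.isLt
              have h2 : (ρ.2 : ℕ) + 1 ≤ Lb := ρ.2.isLt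
              have : (ρ.2 : ℕ) * h + h ≤ Lb * h := by nlinarith
              have : h * Lb = Lb * h := Nat.mul_comm _ _
              omega
      omega
  -- hence `Pp = 0`
  have hP0 : Pp = 0 := by
    rcases hdeg with hdeg | h0
    · set k := 2 ^ J₀ * S₀ / 2 with hk
      have hinj : Function.Injective (fun i : Fin k => ((2 * (i : ℕ) + 1 : ℕ) : ℂ)) := by
        intro i i' hii'
        have hii : ((2 * (i : ℕ) + 1 : ℕ) : ℂ) = ((2 * (i' : ℕ) + 1 : ℕ) : ℂ) := hii'
        have : (2 * (i : ℕ) + 1 : ℕ) = 2 * (i' : ℕ) + 1 := by exact_mod_cast hii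
        exact Fin.ext (by omega)
      refine Polynomial.eq_zero_of_natDegree_lt_card_of_eval_eq_zero Pp hinj (fun i => ?_) ?_
      · have hi : 2 * (i : ℕ) + 1 < 2 ^ J₀ * S₀ := by have := i.isLt; omega
        exact heval _ hi ⟨i, by ring⟩
      · rw [Fintype.card_fin]; exact lt_of_lt_of_le hdeg hcount
    · -- no `ρ` at all
      rw [hPp]
      rcases Nat.mul_eq_zero.mp h0 with h0 | h0
      · haveI : IsEmpty (Fin h × Fin Lb) := by rw [h0]; infer_instance
        exact Finset.sum_eq_zero fun ρ _ => (IsEmpty.false ρ).elim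
      · haveI : IsEmpty (Fin h × Fin Lb) := by rw [h0]; infer_instance
        exact Finset.sum_eq_zero fun ρ _ => (IsEmpty.false ρ).elim
  -- all `p(ρ,0,0) = 0`
  have hc0 : ∀ ρ, c ρ = 0 := fun ρ =>
    eq_zero_of_sum_smul_eq_zero_of_natDegree_injOn univ (fun ρ : Fin h × Fin Lb => wPoly (ρ.1 : ℕ) (ρ.2 : ℕ) h)
      (fun ρ _ => wPoly_ne_zero _ _ _) natDegree_wPoly_injOn c (by rw [← hPp, hP0]) ρ (mem_univ ρ)
  -- contradiction with `p ≠ 0`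
  obtain ⟨u, hu⟩ := inv.nonzero
  have hub := inv.supp u hu
  obtain ⟨h1, h2⟩ := S.eq_zero_of_mem_box_top hL hLθ hub
  have : p u = 0 := by
    have hcu := hc0 u.1
    simp only [hc] at hcu
    rcases u with ⟨ρ, lam, lamθ⟩
    simp only at h1 h2 hcu ⊢
    subst h1; subst h2
    exact_mod_cast hcu
  exact hu this

end Setup

end Literature.NumberTheory.Transcendental.CW77

end

/-!
# Cijsouw–Waldschmidt 1977 over `ℚ` (`p = 2`): Step 1, the construction of the `p(λ)` (Siegel's lemma)

The relations `coreSum_{0,τ}(s) = 0` (`|τ| < T`, `s < S₀`) are linear equations in the unknowns `p(u)`,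
`u` in the box of level `0`, with rational coefficients `qTerm`; multiplied by
`D(s,τ) = ν(2^{J₀}s, h)^{τ₀} · |b_θ|^{|τ'|} · (∏ⱼ den αⱼ^{Lⱼ s}) · den θ^{L_θ s}` they have integer
coefficients (Baker's Lemma 1 for the `Δ`-factor; `b_θ γⱼ = λⱼ b_θ − λ_θ bⱼ ∈ ℤ`; denominators of the
`αⱼ^{λⱼ s}`), and Siegel's lemma (Mathlib's `Int.Matrix.exists_ne_zero_int_vec_norm_le`) gives a non-zero
integer solution of size `≤ #box · max(1, max |coefficient|)` as soon as there are more than twice as many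
unknowns as equations (p. 185, Step 1; Lemma 1 p. 179).
-/

noncomputable section

open Complex Finset Polynomial
open Literature.NumberTheory.Transcendental.Baker1975
open Literature.NumberTheory.Transcendental.Baker1975.Ch3

namespace Literature.NumberTheory.Transcendental.CW77

attribute [local instance] Matrix.seminormedAddCommGroup

namespace Setup

variable (S : Setup) {h Lb : ℕ}

/-- The set of derivative multi-indices `τ` with `|τ| < T`. [cite: CijsouwWaldschmidt1977, §4 Step 1 (p. 185)] -/
def tauSet (d T : ℕ) : Finset (Tau d) :=
  ((range T) ×ˢ Fintype.piFinset fun _ : Fin d => range T).filter fun τ => tauNorm τ < T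

/-- `τ ∈ tauSet ⟺ |τ| < T`. [folklore] -/
theorem mem_tauSet {d T : ℕ} {τ : Tau d} : τ ∈ tauSet d T ↔ tauNorm τ < T := by
  unfold tauSet
  simp only [mem_filter, mem_product, mem_range, Fintype.mem_piFinset, and_iff_right_iff_imp]
  intro hτ
  unfold tauNorm at hτ
  refine ⟨by omega, fun j => ?_⟩
  have : τ.2 j ≤ ∑ i, τ.2 i := Finset.single_le_sum (fun i _ => Nat.zero_le _) (mem_univ j)
  omega

/-- The clearing denominator of the equation `(s, τ)`:
`D(s,τ) = ν(2^{J₀}s, h)^{τ₀} · |b_θ|^{|τ'|} · (∏ⱼ den αⱼ^{Lⱼ s}) · den θ^{L_θ s}`.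
[cite: CijsouwWaldschmidt1977, §4 Step 1 (p. 185)] -/
def Dclear (J₀ : ℕ) (L : Fin S.d → ℕ) (Lθ : ℕ) (s : ℕ) (τ : Tau S.d) : ℕ :=
  nuBound (scale J₀ 0 * s) h ^ τ.1 * S.bθ.natAbs ^ (∑ j, τ.2 j) *
    ((∏ j, (S.α j).den ^ (L j * s)) * S.θ.den ^ (Lθ * s))

/-- `D(s,τ) > 0`. [folklore] -/
theorem Dclear_pos (J₀ : ℕ) (L : Fin S.d → ℕ) (Lθ : ℕ) (s : ℕ) (τ : Tau S.d) : 0 < S.Dclear (h := h) J₀ L Lθ s τ := by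
  unfold Dclear
  refine Nat.mul_pos (Nat.mul_pos (Nat.pow_pos (nuBound_pos _ _)) (Nat.pow_pos ?_)) (Nat.mul_pos ?_ (Nat.pow_pos S.θ.pos))
  · exact Int.natAbs_pos.mpr S.bθ_ne
  · exact prod_pos fun j _ => Nat.pow_pos (S.α j).pos

/-- `ν^{τ₀} · qΔ ∈ ℤ` (Baker's Lemma 1). [cite: BakerTNT1975, Ch. 3 §2 Lemma 1] -/
theorem exists_int_qΔ (J₀ J : ℕ) (u : Idx S.d h Lb) (τ₀ s : ℕ) :
    ∃ z : ℤ, ((nuBound (scale J₀ J * s) h ^ τ₀ : ℕ) : ℚ) * S.qΔ J₀ J u τ₀ s = z := by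
  unfold qΔ
  have hν : ((nuBound (scale J₀ J * s) h ^ τ₀ : ℕ) : ℚ) ≠ 0 := by
    exact_mod_cast (Nat.pow_pos (nuBound_pos _ _)).ne'
  refine ⟨(τ₀.factorial * (scale J₀ J ^ τ₀ * hdNat (b := (u.1.2 : ℕ)) (le_of_lt u.1.1.isLt) (scale J₀ J * s) τ₀) : ℕ), ?_⟩
  field_simp
  push_cast; ring

/-- `b_θ γⱼ ∈ ℤ` (`b_θ γⱼ = λⱼ b_θ − λ_θ bⱼ`). [folklore] -/
theorem bθ_mul_γ (u : Idx S.d h Lb) (j : Fin S.d) :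
    (S.bθ : ℚ) * S.γ u j = ((u.2.1 j : ℤ) * S.bθ - (u.2.2 : ℤ) * S.b j : ℤ) := by
  unfold γ β
  have hb : (S.bθ : ℚ) ≠ 0 := by exact_mod_cast S.bθ_ne
  push_cast
  field_simp
  ring

/-- `|b_θ|^{|τ'|} · qA ∈ ℤ`. [folklore] -/
theorem exists_int_qA (u : Idx S.d h Lb) (τ' : Fin S.d → ℕ) :
    ∃ z : ℤ, ((S.bθ.natAbs ^ (∑ j, τ' j) : ℕ) : ℚ) * S.qA u τ' = z := by
  unfold qA
  refine ⟨(S.bθ.sign) ^ (∑ j, τ' j) * ∏ j : Fin S.d, ((u.2.1 j : ℤ) * S.bθ - (u.2.2 : ℤ) * S.b j) ^ τ' j, ?_⟩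
  have habs : ((S.bθ.natAbs : ℕ) : ℚ) = (S.bθ.sign : ℚ) * S.bθ := by
    rw [Nat.cast_natAbs, Int.cast_abs]
    rcases lt_or_gt_of_ne S.bθ_ne with hneg | hpos
    · rw [abs_of_neg (by exact_mod_cast hneg), Int.sign_eq_neg_one_of_neg hneg]; push_cast; ring
    · rw [abs_of_pos (by exact_mod_cast hpos), Int.sign_eq_one_of_pos hpos]; push_cast; ring
  push_cast
  rw [habs]
  calc ((S.bθ.sign : ℚ) * S.bθ) ^ (∑ j, τ' j) * ∏ j, S.γ u j ^ τ' j
      = (S.bθ.sign : ℚ) ^ (∑ j, τ' j) * ((S.bθ : ℚ) ^ (∑ j, τ' j) * ∏ j, S.γ u j ^ τ' j) := by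
        rw [mul_pow]; ring
    _ = (S.bθ.sign : ℚ) ^ (∑ j, τ' j) * ∏ j, ((S.bθ : ℚ) * S.γ u j) ^ τ' j := by
        congr 1
        rw [← Finset.prod_pow_eq_pow_sum, ← prod_mul_distrib]
        exact prod_congr rfl fun j _ => by rw [mul_pow]
    _ = (S.bθ.sign : ℚ) ^ (∑ j, τ' j) * ∏ j, (((u.2.1 j : ℤ) * S.bθ - (u.2.2 : ℤ) * S.b j : ℤ) : ℚ) ^ τ' j := by
        congr 1
        exact prod_congr rfl fun j _ => by rw [S.bθ_mul_γ]
    _ = _ := by push_cast; ring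

/-- `(∏ den αⱼ^{Lⱼ s}) den θ^{L_θ s} · qE ∈ ℤ` on the box (`λⱼ ≤ Lⱼ`, `λ_θ ≤ L_θ`). [folklore] -/
theorem exists_int_qE {L : Fin S.d → ℕ} {Lθ : ℕ} {u : Idx S.d h Lb} (hu : (∀ j, u.2.1 j ≤ L j) ∧ u.2.2 ≤ Lθ)
    (s : ℕ) : ∃ z : ℤ, (((∏ j, (S.α j).den ^ (L j * s)) * S.θ.den ^ (Lθ * s) : ℕ) : ℚ) * S.qE u s = z := by
  unfold qE
  -- `den^{L s} α^{λ s} = den^{(L-λ) s} · num^{λ s}`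
  have hone : ∀ (q : ℚ) (lam Lq : ℕ), lam ≤ Lq → ∃ z : ℤ, ((q.den ^ (Lq * s) : ℕ) : ℚ) * q ^ (lam * s) = z := by
    intro q lam Lq hle
    refine ⟨(q.den : ℤ) ^ ((Lq - lam) * s) * q.num ^ (lam * s), ?_⟩
    have hsplit : Lq * s = (Lq - lam) * s + lam * s := by rw [← add_mul, Nat.sub_add_cancel hle]
    rw [hsplit, pow_add]
    push_cast
    rw [mul_assoc, ← mul_pow, Rat.den_mul_eq_num]
  choose zα hzα using fun j => hone (S.α j) (u.2.1 j) (L j) (hu.1 j)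
  obtain ⟨zθ, hzθ⟩ := hone S.θ u.2.2 Lθ hu.2
  refine ⟨(∏ j, zα j) * zθ, ?_⟩
  have hα' : ∏ j, ((((S.α j).den : ℚ)) ^ (L j * s) * (S.α j) ^ (u.2.1 j * s)) = ∏ j, (zα j : ℚ) :=
    prod_congr rfl fun j _ => by exact_mod_cast hzα j
  push_cast at hzθ ⊢
  calc (∏ j, (((S.α j).den : ℚ)) ^ (L j * s)) * ((S.θ.den : ℚ)) ^ (Lθ * s) *
        ((∏ j, S.α j ^ (u.2.1 j * s)) * S.θ ^ (u.2.2 * s))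
      = (∏ j, ((((S.α j).den : ℚ)) ^ (L j * s) * (S.α j) ^ (u.2.1 j * s))) *
          (((S.θ.den : ℚ)) ^ (Lθ * s) * S.θ ^ (u.2.2 * s)) := by rw [prod_mul_distrib]; ring
    _ = (∏ j, (zα j : ℚ)) * (zθ : ℚ) := by rw [hα', hzθ]

/-- **The cleared coefficients are integers**: `D(s,τ) · qTerm ∈ ℤ` on the box of level `0`.
[cite: CijsouwWaldschmidt1977, §4 Step 1 (p. 185)] -/
theorem exists_int_Dclear_mul_qTerm (J₀ : ℕ) {L : Fin S.d → ℕ} {Lθ : ℕ} {u : Idx S.d h Lb}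
    (hu : u ∈ S.box (h := h) (Lb := Lb) L Lθ 0) (τ : Tau S.d) (s : ℕ) :
    ∃ z : ℤ, ((S.Dclear (h := h) J₀ L Lθ s τ : ℕ) : ℚ) * S.qTerm J₀ 0 u τ s = z := by
  rw [S.mem_box] at hu
  simp only [pow_zero, Nat.div_one] at hu
  obtain ⟨z₁, hz₁⟩ := S.exists_int_qΔ J₀ 0 u τ.1 s
  obtain ⟨z₂, hz₂⟩ := S.exists_int_qA u τ.2
  obtain ⟨z₃, hz₃⟩ := S.exists_int_qE hu s
  refine ⟨z₁ * z₂ * z₃, ?_⟩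
  unfold Dclear qTerm
  push_cast at hz₁ hz₂ hz₃ ⊢
  rw [← hz₁, ← hz₂, ← hz₃]; ring

/-- **Step 1 (Siegel's lemma).** If there are more than twice as many unknowns in the box of level `0`
as equations `(s, τ)` (`s < S₀`, `|τ| < T`, `S₀, T ≥ 1`), and the cleared coefficients are bounded by
`Amax ≥ 1`, then there are integers `p(u)`, not all zero, supported in the box, bounded by
`#box · Amax`, satisfying all the relations of level `0`: the invariant `Inv` at `J = 0`.
[cite: CijsouwWaldschmidt1977, §4 Step 1 (pp. 185–186)] -/
theorem siegel_step (J₀ : ℕ) (L : Fin S.d → ℕ) (Lθ S₀ T : ℕ) (hS₀ : 1 ≤ S₀) (hT : 1 ≤ T)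
    (hcard : 2 * ((range S₀) ×ˢ tauSet S.d T).card ≤ (S.box (h := h) (Lb := Lb) L Lθ 0).card)
    {Amax : ℝ} (hAmax : 1 ≤ Amax)
    (hA : ∀ s, s < S₀ → ∀ τ : Tau S.d, tauNorm τ < T → ∀ u ∈ S.box (h := h) (Lb := Lb) L Lθ 0,
      |((S.Dclear (h := h) J₀ L Lθ s τ : ℕ) : ℝ) * (S.qTerm J₀ 0 u τ s : ℝ)| ≤ Amax) :
    ∃ p : Idx S.d h Lb → ℤ, S.Inv J₀ L Lθ S₀ T ⌈((S.box (h := h) (Lb := Lb) L Lθ 0).card : ℝ) * Amax⌉ 0 p := by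
  classical
  set boxZ := S.box (h := h) (Lb := Lb) L Lθ 0 with hboxZ
  set eqs := (range S₀) ×ˢ tauSet S.d T with heqs
  -- the integer matrix
  have hint : ∀ (e : eqs) (u : boxZ), ∃ z : ℤ,
      ((S.Dclear (h := h) J₀ L Lθ e.1.1 e.1.2 : ℕ) : ℚ) * S.qTerm J₀ 0 u.1 e.1.2 e.1.1 = z :=
    fun e u => S.exists_int_Dclear_mul_qTerm J₀ u.2 e.1.2 e.1.1
  choose Az hAz using hint
  set A : Matrix eqs boxZ ℤ := Matrix.of fun e u => Az e u with hAdef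
  -- cardinalities
  have hm : 0 < Fintype.card eqs := by
    rw [Fintype.card_coe]
    refine Finset.card_pos.mpr ⟨(0, ((0 : ℕ), (0 : Fin S.d → ℕ))), ?_⟩
    rw [heqs, mem_product, mem_range, mem_tauSet]
    unfold tauNorm
    simpa using ⟨hS₀, hT⟩
  have hn : Fintype.card eqs < Fintype.card boxZ := by
    rw [Fintype.card_coe, Fintype.card_coe]
    have : 0 < eqs.card := by rwa [Fintype.card_coe] at hm
    omega
  obtain ⟨t, ht0, hAt, htnorm⟩ := Int.Matrix.exists_ne_zero_int_vec_norm_le A hn hm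
  -- entries of `A` are bounded by `Amax`, hence `‖t‖ ≤ #box · Amax`
  have hAnorm : ‖A‖ ≤ Amax := by
    rw [Matrix.norm_le_iff (by linarith)]
    intro e u
    have h1 := hAz e u
    have hmem : (e : ℕ × Tau S.d) ∈ range S₀ ×ˢ tauSet S.d T := e.2
    rw [mem_product, mem_range, mem_tauSet] at hmem
    have h2 := hA e.1.1 hmem.1 e.1.2 hmem.2 u.1 u.2
    have hcast : ((S.Dclear (h := h) J₀ L Lθ e.1.1 e.1.2 : ℕ) : ℝ) * (S.qTerm J₀ 0 u.1 e.1.2 e.1.1 : ℝ) =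
        ((Az e u : ℤ) : ℝ) := by
      have := congrArg (fun q : ℚ => (q : ℝ)) h1
      push_cast at this
      exact this
    rw [hAdef, Matrix.of_apply, Int.norm_eq_abs]
    rwa [hcast] at h2
  have htle : ∀ u : boxZ, |(t u : ℝ)| ≤ (boxZ.card : ℝ) * Amax := by
    intro u
    have h1 : ‖t u‖ ≤ ‖t‖ := norm_le_pi_norm t u
    rw [Int.norm_eq_abs] at h1
    refine h1.trans (htnorm.trans ?_)
    have hbase : (1 : ℝ) ≤ (Fintype.card boxZ : ℝ) * max 1 ‖A‖ := by
      have : (1 : ℝ) ≤ Fintype.card boxZ := by exact_mod_cast (show 1 ≤ Fintype.card boxZ by omega)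
      nlinarith [le_max_left (1 : ℝ) ‖A‖]
    have hexp : (Fintype.card eqs : ℝ) / (Fintype.card boxZ - Fintype.card eqs) ≤ 1 := by
      rw [div_le_one (by rw [sub_pos]; exact_mod_cast hn)]
      have : 2 * (Fintype.card eqs : ℝ) ≤ Fintype.card boxZ := by
        rw [Fintype.card_coe, Fintype.card_coe]; exact_mod_cast hcard
      linarith
    calc ((Fintype.card boxZ : ℝ) * max 1 ‖A‖) ^ ((Fintype.card eqs : ℝ) / (Fintype.card boxZ - Fintype.card eqs))
        ≤ ((Fintype.card boxZ : ℝ) * max 1 ‖A‖) ^ (1 : ℝ) :=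
          Real.rpow_le_rpow_of_exponent_le hbase hexp
      _ = (Fintype.card boxZ : ℝ) * max 1 ‖A‖ := Real.rpow_one _
      _ ≤ (boxZ.card : ℝ) * Amax := by
          rw [Fintype.card_coe]
          exact mul_le_mul_of_nonneg_left (max_le hAmax hAnorm) (by positivity)
  -- the vector `p`
  set p : Idx S.d h Lb → ℤ := fun u => if hu : u ∈ boxZ then t ⟨u, hu⟩ else 0 with hp
  have hp_mem : ∀ u (hu : u ∈ boxZ), p u = t ⟨u, hu⟩ := fun u hu => by simp only [hp, dif_pos hu]
  refine ⟨p, ⟨?_, ?_, ?_, ?_⟩⟩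
  · -- support
    intro u hu
    by_contra hnot
    exact hu (dif_neg hnot)
  · -- not all zero
    obtain ⟨u, hu⟩ := Function.ne_iff.mp ht0
    refine ⟨u.1, ?_⟩
    rw [hp_mem u.1 u.2]; exact hu
  · -- bound
    intro u
    by_cases hu : u ∈ boxZ
    · rw [hp_mem u hu]
      have h1 := htle ⟨u, hu⟩
      have h2 : ((t ⟨u, hu⟩ : ℤ) : ℝ) ≤ ⌈(boxZ.card : ℝ) * Amax⌉ := (le_abs_self _).trans (h1.trans (Int.le_ceil _))
      have h3 : (-(t ⟨u, hu⟩ : ℤ) : ℝ) ≤ ⌈(boxZ.card : ℝ) * Amax⌉ := (neg_le_abs _).trans (h1.trans (Int.le_ceil _))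
      rw [abs_le]
      constructor
      · have : -(⌈(boxZ.card : ℝ) * Amax⌉ : ℤ) ≤ t ⟨u, hu⟩ := by exact_mod_cast (by linarith : (-(⌈(boxZ.card : ℝ) * Amax⌉ : ℤ) : ℝ) ≤ t ⟨u, hu⟩)
        exact this
      · exact_mod_cast h2
    · simp only [hp, dif_neg hu, abs_zero]
      exact Int.ceil_nonneg (by positivity)
  · -- relations
    intro s hs _hodd τ hτ
    rw [pow_zero, one_mul] at hs
    rw [pow_zero, Nat.div_one] at hτ
    have hmem : (s, τ) ∈ eqs := by
      rw [heqs, mem_product, mem_range, mem_tauSet]; exact ⟨hs, hτ⟩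
    have hrow := congrFun hAt ⟨(s, τ), hmem⟩
    simp only [Matrix.mulVec, dotProduct, Pi.zero_apply] at hrow
    -- cast to `ℚ` and insert the coefficients
    have hD : ((S.Dclear (h := h) J₀ L Lθ s τ : ℕ) : ℚ) ≠ 0 := by exact_mod_cast (S.Dclear_pos J₀ L Lθ s τ).ne'
    have hsum : ((S.Dclear (h := h) J₀ L Lθ s τ : ℕ) : ℚ) * S.coreSum J₀ 0 boxZ p τ s =
        ((∑ u : boxZ, A ⟨(s, τ), hmem⟩ u * t u : ℤ) : ℚ) := by
      unfold coreSum
      rw [mul_sum, ← Finset.sum_coe_sort boxZ]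
      push_cast
      refine sum_congr rfl fun u _ => ?_
      rw [hAdef, Matrix.of_apply, ← hAz ⟨(s, τ), hmem⟩ u, hp_mem u.1 u.2]
      simp only; ring
    rw [hrow] at hsum
    simp only [Int.cast_zero, mul_eq_zero] at hsum
    exact hsum.resolve_left hD

end Setup

end Literature.NumberTheory.Transcendental.CW77

end

/-!
# Cijsouw–Waldschmidt 1977 over `ℚ` (`p = 2`): the analytic half of one step of the descent

From the invariant at level `J < J₀` to the vanishing of `φ_{J,τ}(s/2)` for odd `s < 2^{J+1} S₀`,
`|τ| < T/2^{J+1}` (pp. 187–189): the relations give `φ_{J,τ''}(s') = 0` at the odd `s' < 2^J S₀`;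
Lemma 9 makes `f_{J,τ''}(s')` small, hence (differential equations) all the derivatives
`f_{J,τ}^{(σ)}(s')`; Cijsouw–Waldschmidt's Lemma 2 (here `CW77.hermite_integer_points` applied to
`g(z) = f_{J,τ}(2z+1)`, whose integer points are the odd points of `f`) makes `f_{J,τ}` small on a
disc containing the `s/2`; Lemma 9 again makes `φ_{J,τ}(s/2)` small; it is `2^{τ₀}∏lⱼ^{τ'ⱼ}` times
the evaluation of the class-sum vector on the square-root monomials, so Lemma 10
(`CW77.abs_ev_ge`) forces the class sums — hence `φ_{J,τ}(s/2)` — to vanish, once the final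
inequality between the smallness and the Liouville bound holds (a hypothesis here, verified with
the parameters of the numerics file).
-/

noncomputable section

open Complex Finset Polynomial
open Literature.NumberTheory.Transcendental.Baker1975
open Literature.NumberTheory.Transcendental.Baker1975.Ch3

namespace Literature.NumberTheory.Transcendental.CW77

namespace Setup

variable (S : Setup) {h Lb : ℕ}

/-- The clearing denominator of `rHalf` at `(s, τ)` on the box of level `J`:
`ν(2^{J₀−J−1}s, h)^{τ₀} · |b_θ|^{|τ'|} · (∏ⱼ den αⱼ^{⌊Lⱼ/2^J⌋ s}) · den θ^{⌊L_θ/2^J⌋ s}`.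
[cite: CijsouwWaldschmidt1977, §4 Lemma 10 (p. 188)] -/
def Dhalf (J₀ J : ℕ) (L : Fin S.d → ℕ) (Lθ : ℕ) (s : ℕ) (τ : Tau S.d) : ℕ :=
  nuBound (scale J₀ (J + 1) * s) h ^ τ.1 * S.bθ.natAbs ^ (∑ j, τ.2 j) *
    ((∏ j, (S.α j).den ^ (L j / 2 ^ J * s)) * S.θ.den ^ (Lθ / 2 ^ J * s))

/-- `Dhalf > 0`. [folklore] -/
theorem Dhalf_pos (J₀ J : ℕ) (L : Fin S.d → ℕ) (Lθ : ℕ) (s : ℕ) (τ : Tau S.d) :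
    0 < S.Dhalf (h := h) J₀ J L Lθ s τ := by
  unfold Dhalf
  refine Nat.mul_pos (Nat.mul_pos (Nat.pow_pos (nuBound_pos _ _)) (Nat.pow_pos ?_)) (Nat.mul_pos ?_ (Nat.pow_pos S.θ.pos))
  · exact Int.natAbs_pos.mpr S.bθ_ne
  · exact prod_pos fun j _ => Nat.pow_pos (S.α j).pos

/-- `(∏ den αⱼ^{⌊Lⱼ/2^J⌋ s}) den θ^{⌊L_θ/2^J⌋ s} · qEh ∈ ℤ` on the box of level `J`. [folklore] -/
theorem exists_int_qEh {L : Fin S.d → ℕ} {Lθ J : ℕ} {u : Idx S.d h Lb}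
    (hu : u ∈ S.box (h := h) (Lb := Lb) L Lθ J) (s : ℕ) :
    ∃ z : ℤ, (((∏ j, (S.α j).den ^ (L j / 2 ^ J * s)) * S.θ.den ^ (Lθ / 2 ^ J * s) : ℕ) : ℚ) * S.qEh u s = z := by
  rw [S.mem_box] at hu
  have hone : ∀ (q : ℚ) (e Lq : ℕ), e ≤ Lq * s → ∃ z : ℤ, ((q.den ^ (Lq * s) : ℕ) : ℚ) * q ^ e = z := by
    intro q e Lq hle
    refine ⟨(q.den : ℤ) ^ (Lq * s - e) * q.num ^ e, ?_⟩
    have hsplit : Lq * s = (Lq * s - e) + e := (Nat.sub_add_cancel hle).symm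
    rw [hsplit, pow_add]
    push_cast
    rw [mul_assoc, ← mul_pow, Rat.den_mul_eq_num]
    congr 2; omega
  have hlam : ∀ j, S.expn u s (Fin.castSucc j) / 2 ≤ L j / 2 ^ J * s := by
    intro j
    rw [S.expn_castSucc]
    calc u.2.1 j * s / 2 ≤ u.2.1 j * s := Nat.div_le_self _ _
      _ ≤ L j / 2 ^ J * s := Nat.mul_le_mul_right _ (hu.1 j)
  have hθ' : S.expn u s (Fin.last S.d) / 2 ≤ Lθ / 2 ^ J * s := by
    rw [S.expn_last]
    calc u.2.2 * s / 2 ≤ u.2.2 * s := Nat.div_le_self _ _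
      _ ≤ Lθ / 2 ^ J * s := Nat.mul_le_mul_right _ hu.2
  choose zα hzα using fun j => hone (S.α j) _ (L j / 2 ^ J) (hlam j)
  obtain ⟨zθ, hzθ⟩ := hone S.θ _ (Lθ / 2 ^ J) hθ'
  refine ⟨(∏ j, zα j) * zθ, ?_⟩
  unfold qEh
  rw [Fin.prod_univ_castSucc]
  unfold all
  simp only [Fin.snoc_castSucc, Fin.snoc_last]
  have hα' : ∏ j, ((((S.α j).den : ℚ)) ^ (L j / 2 ^ J * s) * (S.α j) ^ (S.expn u s (Fin.castSucc j) / 2)) =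
      ∏ j, (zα j : ℚ) :=
    prod_congr rfl fun j _ => by exact_mod_cast hzα j
  push_cast at hzθ ⊢
  calc (∏ j, (((S.α j).den : ℚ)) ^ (L j / 2 ^ J * s)) * ((S.θ.den : ℚ)) ^ (Lθ / 2 ^ J * s) *
        ((∏ j, S.α j ^ (S.expn u s (Fin.castSucc j) / 2)) * S.θ ^ (S.expn u s (Fin.last S.d) / 2))
      = (∏ j, ((((S.α j).den : ℚ)) ^ (L j / 2 ^ J * s) * (S.α j) ^ (S.expn u s (Fin.castSucc j) / 2))) *
          (((S.θ.den : ℚ)) ^ (Lθ / 2 ^ J * s) * S.θ ^ (S.expn u s (Fin.last S.d) / 2)) := by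
        rw [prod_mul_distrib]; ring
    _ = (∏ j, (zα j : ℚ)) * (zθ : ℚ) := by rw [hα', hzθ]

/-- **`Dhalf · rHalf ∈ ℤ`** on the box of level `J`. [cite: CijsouwWaldschmidt1977, §4 Lemma 10 (p. 188)] -/
theorem exists_int_Dhalf_mul_rHalf (J₀ J : ℕ) {L : Fin S.d → ℕ} {Lθ : ℕ} {u : Idx S.d h Lb}
    (hu : u ∈ S.box (h := h) (Lb := Lb) L Lθ J) (τ : Tau S.d) (s : ℕ) :
    ∃ z : ℤ, ((S.Dhalf (h := h) J₀ J L Lθ s τ : ℕ) : ℚ) * S.rHalf J₀ J u τ s = z := by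
  obtain ⟨z₁, hz₁⟩ := S.exists_int_qΔ J₀ (J + 1) u τ.1 s
  obtain ⟨z₂, hz₂⟩ := S.exists_int_qA u τ.2
  obtain ⟨z₃, hz₃⟩ := S.exists_int_qEh hu s
  refine ⟨z₁ * z₂ * z₃, ?_⟩
  unfold Dhalf rHalf
  push_cast at hz₁ hz₂ hz₃ ⊢
  rw [← hz₁, ← hz₂, ← hz₃]; ring

/-- `Dhalf · classVec(T) ∈ ℤ`. [folklore] -/
theorem exists_int_Dhalf_mul_classVec (J₀ J : ℕ) (L : Fin S.d → ℕ) (Lθ : ℕ) {p : Idx S.d h Lb → ℤ}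
    (τ : Tau S.d) (s : ℕ) (T : Finset (Fin (S.d + 1))) :
    ∃ z : ℤ, ((S.Dhalf (h := h) J₀ J L Lθ s τ : ℕ) : ℚ) *
      S.classVec J₀ J (S.box (h := h) (Lb := Lb) L Lθ J) p τ s T = z := by
  classical
  unfold classVec
  rw [mul_sum]
  have hterm : ∀ u ∈ (S.box (h := h) (Lb := Lb) L Lθ J).filter (fun u => S.Sset u s = T),
      ∃ z : ℤ, ((S.Dhalf (h := h) J₀ J L Lθ s τ : ℕ) : ℚ) * ((p u : ℚ) * S.rHalf J₀ J u τ s) = z := by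
    intro u hu
    obtain ⟨z, hz⟩ := S.exists_int_Dhalf_mul_rHalf J₀ J (mem_filter.mp hu).1 τ s
    exact ⟨p u * z, by push_cast; rw [← hz]; ring⟩
  choose z hz using hterm
  refine ⟨∑ u ∈ ((S.box (h := h) (Lb := Lb) L Lθ J).filter (fun u => S.Sset u s = T)).attach, z u.1 u.2, ?_⟩
  push_cast
  rw [← sum_attach]
  exact sum_congr rfl fun u _ => hz u.1 u.2

/-- `∑_T |classVec(T)| ≤ ∑_u |p(u)| |rHalf(u)|`. [folklore] -/
theorem sum_abs_classVec_le (J₀ J : ℕ) (box : Finset (Idx S.d h Lb)) (p : Idx S.d h Lb → ℤ)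
    (τ : Tau S.d) (s : ℕ) :
    ∑ T, |(S.classVec J₀ J box p τ s T : ℝ)| ≤ ∑ u ∈ box, |(p u : ℝ)| * |(S.rHalf J₀ J u τ s : ℝ)| := by
  classical
  unfold classVec
  push_cast
  calc ∑ T, |∑ u ∈ box with S.Sset u s = T, (p u : ℝ) * (S.rHalf J₀ J u τ s : ℝ)|
      ≤ ∑ T, ∑ u ∈ box with S.Sset u s = T, |(p u : ℝ) * (S.rHalf J₀ J u τ s : ℝ)| :=
        sum_le_sum fun T _ => abs_sum_le_sum_abs _ _
    _ = ∑ u ∈ box, |(p u : ℝ) * (S.rHalf J₀ J u τ s : ℝ)| :=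
        Finset.sum_fiberwise box (fun u => S.Sset u s) _
    _ = ∑ u ∈ box, |(p u : ℝ)| * |(S.rHalf J₀ J u τ s : ℝ)| := sum_congr rfl fun u _ => abs_mul _ _

set_option maxHeartbeats 800000 in
/-- **The analytic half of Step 2.** Hypotheses: the invariant at level `J < J₀`; `T/2^J ≥ 1`,
`2^J S₀ ≥ 2`; uniform bounds on the box of level `J`: `Q ≥ |Qw m (w_u) 0 z|` (`m ≤ T`, `|z| ≤ 7·2^J S₀`),
`G_A ≥ |A(u,τ')|` (`|τ'| ≤ T`), `Ψ ≥ |ψ_u|, |ψ_u + λ_θΛ₀|`, the smallness `L_θ |Λ₀| · 7·2^J S₀ ≤ x ≤ 1`,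
`Cl ≥ 1 + ∑ |log αⱼ|`, `Rmax ≥ |rHalf|`, `Dmax ≥ Dhalf`; and the final inequality
between the resulting smallness of `φ_{J,τ}(s/2)` and the Liouville bound of Lemma 10. Conclusion:
`φ_{J,τ}(s/2) = 0` for all odd `s < 2^{J+1} S₀` and `|τ| < T/2^{J+1}`.
[cite: CijsouwWaldschmidt1977, §4 Step 2 (pp. 187–189)] -/
theorem half_vanish (hind : ∀ T : Finset (Fin (S.d + 1)), T.Nonempty → ¬ IsSquare (∏ i ∈ T, S.all i))
    {J₀ J : ℕ} (hJ : J < J₀) {L : Fin S.d → ℕ} {Lθ S₀ T : ℕ} {P : ℤ}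
    {p : Idx S.d h Lb → ℤ} (inv : S.Inv J₀ L Lθ S₀ T P J p)
    (hTJ : 1 ≤ T / 2 ^ J) (hSJ : 2 ≤ 2 ^ J * S₀)
    {Nr : ℝ} (hNr : ((S.box (h := h) (Lb := Lb) L Lθ J).card : ℝ) ≤ Nr) (hNr1 : 1 ≤ Nr)
    {Q GA Ψ x Cl Rmax Dmax Pr : ℝ} (hP : (P : ℝ) ≤ Pr) (hPr : 1 ≤ Pr)
    (hQ : ∀ u ∈ S.box (h := h) (Lb := Lb) L Lθ J, ∀ m, m ≤ T → ∀ z : ℂ, ‖z‖ ≤ 7 * (2 ^ J * S₀ : ℕ) →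
      ‖Qw m (S.wOf J₀ J u) 0 z‖ ≤ Q) (hQ1 : 1 ≤ Q)
    (hA : ∀ u ∈ S.box (h := h) (Lb := Lb) L Lθ J, ∀ τ' : Fin S.d → ℕ, ∑ j, τ' j ≤ T → ‖S.A u τ'‖ ≤ GA) (hGA1 : 1 ≤ GA)
    (hψ : ∀ u ∈ S.box (h := h) (Lb := Lb) L Lθ J, |S.ψ u| ≤ Ψ ∧ |S.expo u| ≤ Ψ) (hΨ0 : 0 ≤ Ψ)
    (hx : ((Lθ / 2 ^ J : ℕ) : ℝ) * |S.Λ₀| * (7 * (2 ^ J * S₀ : ℕ)) ≤ x) (hx1 : x ≤ 1) (hx0 : 0 ≤ x)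
    (hCl : 1 + ∑ j, |S.l j| ≤ Cl)
    (hR : ∀ u ∈ S.box (h := h) (Lb := Lb) L Lθ J, ∀ τ : Tau S.d, tauNorm τ < T → ∀ s, s < 2 ^ (J + 1) * S₀ →
      |(S.rHalf J₀ J u τ s : ℝ)| ≤ Rmax) (hR1 : 1 ≤ Rmax)
    (hD : ∀ τ : Tau S.d, tauNorm τ < T → ∀ s, s < 2 ^ (J + 1) * S₀ → ((S.Dhalf (h := h) J₀ J L Lθ s τ : ℕ) : ℝ) ≤ Dmax)
    (hfinal :
      let N : ℝ := Nr
      let kpts : ℕ := 2 ^ J * S₀ / 2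
      let t : ℕ := T / 2 ^ J - T / 2 ^ (J + 1)
      let ε₉ : ℝ := N * Pr * (Q * GA * Real.exp (Ψ * (7 * (2 ^ J * S₀ : ℕ)))) * (2 * x)
      let Bf : ℝ := N * Pr * (Q * GA * Real.exp (Ψ * (7 * (2 ^ J * S₀ : ℕ))))
      let δ : ℝ := 2 * (kpts : ℝ) ^ (t + 1) * t * (28 * Real.exp 1) ^ (kpts * t) *
          ((2 * Cl) ^ t * ε₉) + Bf * (3 / 5) ^ (kpts * t) + ε₉
      δ < 1 / (2 * Dmax * (N * Pr * Rmax) * heightProd S.all) ^ (4 ^ (S.d + 1 + 1))) :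
    ∀ s, s < 2 ^ (J + 1) * S₀ → Odd s → ∀ τ : Tau S.d, tauNorm τ < T / 2 ^ (J + 1) →
      S.Φ J₀ J (S.box (h := h) (Lb := Lb) L Lθ J) p τ ((s : ℂ) / 2) = 0 := by
  classical
  intro s hs hodd τ hτ
  set boxJ := S.box (h := h) (Lb := Lb) L Lθ J with hboxJ
  set SJ : ℕ := 2 ^ J * S₀ with hSJdef
  set TJ : ℕ := T / 2 ^ J with hTJdef
  set TJ1 : ℕ := T / 2 ^ (J + 1) with hTJ1def
  set N : ℝ := Nr with hN
  set kpts : ℕ := SJ / 2 with hkpts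
  set t : ℕ := TJ - TJ1 with ht
  set ε₉ : ℝ := N * Pr * (Q * GA * Real.exp (Ψ * (7 * (SJ : ℝ)))) * (2 * x) with hε₉
  set Bf : ℝ := N * Pr * (Q * GA * Real.exp (Ψ * (7 * (SJ : ℝ)))) with hBf
  have hTJ1le : 2 * TJ1 ≤ TJ := by
    rw [hTJ1def, hTJdef, pow_succ, ← Nat.div_div_eq_div_mul]
    omega
  have hTJT : TJ ≤ T := Nat.div_le_self _ _
  have ht1 : 1 ≤ t := by omega
  have hkpts1 : 1 ≤ kpts := by rw [hkpts]; omega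
  have hSJ2 : 2 * kpts ≤ SJ := by rw [hkpts]; omega
  -- basic facts on the box
  have hp_abs : ∀ u ∈ boxJ, |(p u : ℝ)| ≤ Pr := fun u _ => le_trans (by exact_mod_cast inv.bound u) hP
  have hLθ : ∀ u ∈ boxJ, u.2.2 ≤ Lθ / 2 ^ J := fun u hu => (S.mem_box.mp hu).2
  have hN0' : (0 : ℝ) ≤ N := by rw [hN]; linarith
  have hcardN : ∀ {y : ℝ}, 0 ≤ y → (boxJ.card : ℝ) * Pr * y ≤ N * Pr * y := fun hy =>
    mul_le_mul_of_nonneg_right (mul_le_mul_of_nonneg_right (by rw [hN]; exact hNr) (by linarith)) hy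
  -- (1) zeros of `φ` at odd `s' < SJ`
  have hzero : ∀ s', s' < SJ → Odd s' → ∀ τ'' : Tau S.d, tauNorm τ'' < TJ → S.Φ J₀ J boxJ p τ'' (s' : ℂ) = 0 :=
    fun s' hs' ho τ'' hτ'' => (S.Φ_natCast_eq_zero_iff J₀ J boxJ p τ'' s').mpr (inv.rel s' hs' ho τ'' hτ'')
  -- (2) Lemma 9 on `|z| ≤ 7 SJ`
  have hL9 : ∀ τ'' : Tau S.d, tauNorm τ'' ≤ T → ∀ z : ℂ, ‖z‖ ≤ 7 * (SJ : ℝ) →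
      ‖S.F J₀ J boxJ p τ'' z - S.Φ J₀ J boxJ p τ'' z‖ ≤ ε₉ := by
    intro τ'' hτ'' z hz
    have h1 := S.norm_F_sub_Φ_le J₀ J boxJ p τ'' z (P := Pr) (Q := Q) (GA := GA) (Ψ := Ψ) (x := x)
      (Lθ := Lθ / 2 ^ J) hp_abs
      (fun u hu => hQ u hu τ''.1 (by unfold tauNorm at hτ''; omega) z hz)
      (fun u hu => hA u hu τ''.2 (by unfold tauNorm at hτ''; omega))
      (fun u hu => (hψ u hu).1) hLθ
      (le_trans (mul_le_mul_of_nonneg_left hz (by positivity)) hx) hx1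
    have hmono : N * Pr * (Q * GA * Real.exp (Ψ * ‖z‖)) ≤ Bf := by
      rw [hBf]
      apply mul_le_mul_of_nonneg_left _ (mul_nonneg hN0' (by linarith))
      apply mul_le_mul_of_nonneg_left _ (mul_nonneg (by linarith) (by linarith))
      exact Real.exp_le_exp.mpr (mul_le_mul_of_nonneg_left hz hΨ0)
    calc ‖S.F J₀ J boxJ p τ'' z - S.Φ J₀ J boxJ p τ'' z‖
        ≤ (boxJ.card : ℝ) * Pr * (Q * GA * Real.exp (Ψ * ‖z‖)) * (2 * x) := h1
      _ ≤ N * Pr * (Q * GA * Real.exp (Ψ * ‖z‖)) * (2 * x) :=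
          mul_le_mul_of_nonneg_right (hcardN (by positivity)) (by linarith)
      _ ≤ Bf * (2 * x) := mul_le_mul_of_nonneg_right hmono (by linarith)
      _ = ε₉ := by rw [hε₉]
  have hSJ7 : ∀ s', s' < SJ → ‖((s' : ℕ) : ℂ)‖ ≤ 7 * (SJ : ℝ) := by
    intro s' hs'
    rw [Complex.norm_natCast]
    have : (s' : ℝ) ≤ SJ := by exact_mod_cast hs'.le
    have : (0 : ℝ) ≤ SJ := by positivity
    linarith
  -- (3) smallness of `f` at the odd points
  have hFsmall : ∀ s', s' < SJ → Odd s' → ∀ τ'' : Tau S.d, tauNorm τ'' ≤ TJ - 1 →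
      ‖S.F J₀ J boxJ p τ'' (s' : ℂ)‖ ≤ ε₉ := by
    intro s' hs' ho τ'' hτ''
    have h0 := hzero s' hs' ho τ'' (by omega)
    have h1 := hL9 τ'' (by omega) (s' : ℂ) (hSJ7 s' hs')
    rwa [h0, sub_zero] at h1
  -- (4) derivatives of `f_{J,τ}` at the odd points
  set Fτ := S.F J₀ J boxJ p τ with hFτ
  have hε₉0 : 0 ≤ ε₉ := by
    rw [hε₉]
    have : 0 ≤ Pr := by linarith
    have : 0 ≤ Q := by linarith
    have : 0 ≤ GA := by linarith
    positivity
  have hderiv : ∀ s', s' < SJ → Odd s' → ∀ σ, σ < t →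
      ‖iteratedDeriv σ Fτ (s' : ℂ)‖ ≤ (1 + ∑ j, |S.l j|) ^ σ * ε₉ := by
    intro s' hs' ho σ hσ
    refine S.norm_iteratedDeriv_F_le_of_forall J₀ J boxJ p (s' : ℂ) (TJ - 1)
      (fun τ'' hτ'' => hFsmall s' hs' ho τ'' hτ'') σ τ ?_
    omega
  -- (5) the function `g(z) = f_{J,τ}(2z+1)`
  set g : ℂ → ℂ := fun z => Fτ (2 * z + 1) with hg
  have hFdiff : Differentiable ℂ Fτ := S.differentiable_F J₀ J boxJ p τ
  have hg_diff : Differentiable ℂ g := hFdiff.comp (by fun_prop)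
  have hg_eq : g = fun z => (fun y => Fτ (2 * y)) (z + 1 / 2) := by
    funext z; simp only [hg]; congr 1; ring
  have hg_deriv : ∀ σ (z : ℂ), iteratedDeriv σ g z = 2 ^ σ * iteratedDeriv σ Fτ (2 * z + 1) := by
    intro σ z
    rw [hg_eq, iteratedDeriv_comp_add_const σ (fun y => Fτ (2 * y)) (1 / 2)]
    simp only
    rw [iteratedDeriv_comp_const_mul (hFdiff.contDiff) (2 : ℂ)]
    simp only
    congr 2; ring
  have hCl1 : 1 ≤ Cl := le_trans (le_add_of_nonneg_right (sum_nonneg fun j _ => abs_nonneg _)) hCl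
  have hl0 : 0 ≤ 1 + ∑ j, |S.l j| := by positivity
  set εH : ℝ := (2 * Cl) ^ t * ε₉ with hεH
  have hεH0 : 0 ≤ εH := by rw [hεH]; positivity
  have hg_small : ∀ i : ℕ, i < kpts → ∀ σ, σ < t → ‖iteratedDeriv σ g (i : ℂ)‖ ≤ εH := by
    intro i hi σ hσ
    rw [hg_deriv, norm_mul, norm_pow, Complex.norm_ofNat]
    have hodd : Odd (2 * i + 1) := ⟨i, rfl⟩
    have hlt : 2 * i + 1 < SJ := by omega
    have h1 := hderiv (2 * i + 1) hlt hodd σ hσ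
    have hcast : (2 : ℂ) * (i : ℂ) + 1 = (((2 * i + 1 : ℕ)) : ℂ) := by push_cast; ring
    rw [hcast]
    calc (2 : ℝ) ^ σ * ‖iteratedDeriv σ Fτ (((2 * i + 1 : ℕ)) : ℂ)‖
        ≤ 2 ^ σ * ((1 + ∑ j, |S.l j|) ^ σ * ε₉) := mul_le_mul_of_nonneg_left h1 (by positivity)
      _ = (2 * (1 + ∑ j, |S.l j|)) ^ σ * ε₉ := by rw [mul_pow]; ring
      _ ≤ (2 * Cl) ^ σ * ε₉ := by
          apply mul_le_mul_of_nonneg_right _ hε₉0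
          exact pow_le_pow_left₀ (by positivity) (by linarith) σ
      _ ≤ (2 * Cl) ^ t * ε₉ := by
          apply mul_le_mul_of_nonneg_right _ hε₉0
          exact pow_le_pow_right₀ (by linarith) hσ.le
  -- the growth of `g` on `|z| = 6 kpts`
  have hg_bound : ∀ z ∈ Metric.sphere (0 : ℂ) (6 * kpts), ‖g z‖ ≤ Bf := by
    intro z hz
    have hz' : ‖z‖ = 6 * kpts := by simpa using hz
    have h2z : ‖2 * z + 1‖ ≤ 7 * (SJ : ℝ) := by
      calc ‖2 * z + 1‖ ≤ ‖2 * z‖ + ‖(1 : ℂ)‖ := norm_add_le _ _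
        _ = 2 * (6 * kpts) + 1 := by rw [norm_mul, Complex.norm_ofNat, hz', norm_one]
        _ ≤ 7 * SJ := by
            have : (2 * kpts : ℝ) ≤ SJ := by exact_mod_cast hSJ2
            have : (1 : ℝ) ≤ SJ := by exact_mod_cast (by omega : 1 ≤ SJ)
            linarith
    simp only [hg]
    have h1 := S.norm_F_le J₀ J boxJ p τ (2 * z + 1) (P := Pr) (Q := Q) (GA := GA) (Ψ := Ψ) hp_abs
      (fun u hu => hQ u hu τ.1 (by unfold tauNorm at hτ; omega) _ h2z)
      (fun u hu => hA u hu τ.2 (by unfold tauNorm at hτ; omega))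
      (fun u hu => (hψ u hu).2)
    calc ‖S.F J₀ J boxJ p τ (2 * z + 1)‖ ≤ (boxJ.card : ℝ) * Pr * (Q * GA * Real.exp (Ψ * ‖2 * z + 1‖)) := h1
      _ ≤ N * Pr * (Q * GA * Real.exp (Ψ * ‖2 * z + 1‖)) := hcardN (by positivity)
      _ ≤ Bf := by
          rw [hBf]
          apply mul_le_mul_of_nonneg_left _ (mul_nonneg hN0' (by linarith))
          apply mul_le_mul_of_nonneg_left _ (mul_nonneg (by linarith) (by linarith))
          exact Real.exp_le_exp.mpr (mul_le_mul_of_nonneg_left h2z hΨ0)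
  -- (6) Hermite at `w₀ = (s/2 − 1)/2`
  set w₀ : ℂ := ((s : ℂ) / 2 - 1) / 2 with hw₀
  have hw₀2 : 2 * w₀ + 1 = (s : ℂ) / 2 := by rw [hw₀]; ring
  have hw₀n : ‖w₀‖ ≤ 2 * kpts := by
    rw [hw₀, norm_div, Complex.norm_ofNat]
    have h1 : ‖(s : ℂ) / 2 - 1‖ ≤ (s : ℝ) / 2 + 1 := by
      calc ‖(s : ℂ) / 2 - 1‖ ≤ ‖(s : ℂ) / 2‖ + ‖(1 : ℂ)‖ := norm_sub_le _ _
        _ = (s : ℝ) / 2 + 1 := by rw [norm_div, Complex.norm_natCast, Complex.norm_ofNat, norm_one]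
    have hs' : (s : ℝ) ≤ 2 * SJ := by
      have : s < 2 * SJ := by rw [hSJdef]; rw [pow_succ] at hs; linarith
      exact_mod_cast this.le
    have hk : (SJ : ℝ) ≤ 2 * kpts + 1 := by exact_mod_cast (by omega : SJ ≤ 2 * kpts + 1)
    have hk1 : (1 : ℝ) ≤ kpts := by exact_mod_cast hkpts1
    rw [div_le_iff₀ (by norm_num : (0:ℝ) < 2)]
    linarith
  have hH := hermite_integer_points hg_diff hkpts1 ht1 hεH0 hg_small hg_bound hw₀n
  have hFval : ‖Fτ ((s : ℂ) / 2)‖ ≤ 2 * (kpts : ℝ) ^ (t + 1) * t * (28 * Real.exp 1) ^ (kpts * t) * εH +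
      Bf * (3 / 5) ^ (kpts * t) := by
    have : g w₀ = Fτ ((s : ℂ) / 2) := by simp only [hg]; rw [hw₀2]
    rw [← this]; exact hH
  -- (7) Lemma 9 at `s/2`
  have hs2 : ‖(s : ℂ) / 2‖ ≤ 7 * (SJ : ℝ) := by
    rw [norm_div, Complex.norm_natCast, Complex.norm_ofNat]
    have : (s : ℝ) < 2 * SJ := by
      have : s < 2 * SJ := by rw [hSJdef]; rw [pow_succ] at hs; linarith
      exact_mod_cast this
    have : (0 : ℝ) ≤ SJ := by positivity
    rw [div_le_iff₀ (by norm_num : (0:ℝ) < 2)]; linarith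
  have hΦval : ‖S.Φ J₀ J boxJ p τ ((s : ℂ) / 2)‖ ≤
      2 * (kpts : ℝ) ^ (t + 1) * t * (28 * Real.exp 1) ^ (kpts * t) * εH + Bf * (3 / 5) ^ (kpts * t) + ε₉ := by
    have h1 := hL9 τ (by unfold tauNorm at hτ ⊢; omega) ((s : ℂ) / 2) hs2
    have h2 : ‖S.Φ J₀ J boxJ p τ ((s : ℂ) / 2)‖ ≤ ‖Fτ ((s : ℂ) / 2)‖ + ‖Fτ ((s : ℂ) / 2) - S.Φ J₀ J boxJ p τ ((s : ℂ) / 2)‖ := by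
      have := norm_sub_le (Fτ ((s : ℂ) / 2)) (Fτ ((s : ℂ) / 2) - S.Φ J₀ J boxJ p τ ((s : ℂ) / 2))
      rwa [sub_sub_cancel] at this
    linarith
  -- (8) Liouville
  set δ : ℝ := 2 * (kpts : ℝ) ^ (t + 1) * t * (28 * Real.exp 1) ^ (kpts * t) * εH +
      Bf * (3 / 5) ^ (kpts * t) + ε₉ with hδ
  by_cases hcv : S.classVec J₀ J boxJ p τ s = 0
  · rw [S.Φ_half hJ, hcv, ev_zero]; simp
  · exfalso
    -- the Liouville lower bound
    set D : ℕ := S.Dhalf (h := h) J₀ J L Lθ s τ with hDdef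
    have hD1 : 1 ≤ D := S.Dhalf_pos J₀ J L Lθ s τ
    set M : ℝ := N * Pr * Rmax with hM
    have hN1 : (1 : ℝ) ≤ N := by rw [hN]; exact hNr1
    have hN0 : (0 : ℝ) ≤ N := by linarith
    have hM1 : 1 ≤ M := by
      rw [hM]
      have h1 : (1 : ℝ) ≤ N * Pr := by nlinarith
      nlinarith
    have hcM : ∑ T', |(S.classVec J₀ J boxJ p τ s T' : ℝ)| ≤ M := by
      refine (S.sum_abs_classVec_le J₀ J boxJ p τ s).trans ?_
      have hτT : tauNorm τ < T := lt_of_lt_of_le hτ ((Nat.div_le_self _ _))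
      calc ∑ u ∈ boxJ, |(p u : ℝ)| * |(S.rHalf J₀ J u τ s : ℝ)| ≤ ∑ _u ∈ boxJ, Pr * Rmax :=
            sum_le_sum fun u hu => mul_le_mul (hp_abs u hu) (hR u hu τ hτT s hs) (abs_nonneg _) (by linarith)
        _ = (boxJ.card : ℝ) * Pr * Rmax := by rw [sum_const, nsmul_eq_mul]; ring
        _ ≤ M := by rw [hM]; exact hcardN (by linarith)
    have hliou := abs_ev_ge (S.d + 1) S.all S.all_pos hind _ hcv D hD1
      (S.exists_int_Dhalf_mul_classVec J₀ J L Lθ τ s) M hM1 hcM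
    -- the smallness of `|ev|`
    have hev_le : |ev S.all (S.classVec J₀ J boxJ p τ s)| ≤ δ := by
      have hfac := S.Φ_half hJ boxJ p τ s
      have hnorm : ‖S.Φ J₀ J boxJ p τ ((s : ℂ) / 2)‖ =
          2 ^ τ.1 * |ev S.all (S.classVec J₀ J boxJ p τ s)| := by
        rw [hfac, norm_mul, norm_pow, Complex.norm_ofNat, Complex.norm_real, Real.norm_eq_abs]
      have h2 : (1 : ℝ) ≤ 2 ^ τ.1 := one_le_pow₀ (by norm_num)
      calc |ev S.all (S.classVec J₀ J boxJ p τ s)|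
          = 1 * |ev S.all (S.classVec J₀ J boxJ p τ s)| := (one_mul _).symm
        _ ≤ 2 ^ τ.1 * |ev S.all (S.classVec J₀ J boxJ p τ s)| :=
            mul_le_mul_of_nonneg_right h2 (abs_nonneg _)
        _ = ‖S.Φ J₀ J boxJ p τ ((s : ℂ) / 2)‖ := hnorm.symm
        _ ≤ δ := hΦval
    -- comparing with `hfinal`
    have hDle : (D : ℝ) ≤ Dmax := hD τ (lt_of_lt_of_le hτ (Nat.div_le_self _ _)) s hs
    have hPht : 1 ≤ heightProd S.all := one_le_heightProd _
    have hbase : 0 < 2 * (D : ℝ) * M * heightProd S.all := by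
      have : (1 : ℝ) ≤ D := by exact_mod_cast hD1
      positivity
    have hmono : 1 / (2 * Dmax * M * heightProd S.all) ^ (4 ^ (S.d + 1 + 1)) ≤
        1 / (2 * (D : ℝ) * M * heightProd S.all) ^ (4 ^ (S.d + 1 + 1)) := by
      apply one_div_le_one_div_of_le (pow_pos hbase _)
      apply pow_le_pow_left₀ hbase.le
      have : 0 ≤ M * heightProd S.all := by positivity
      nlinarith
    have hfin : δ < 1 / (2 * Dmax * M * heightProd S.all) ^ (4 ^ (S.d + 1 + 1)) := by
      have hM' : (2 * Dmax * M * heightProd S.all) = (2 * Dmax * (N * Pr * Rmax) * heightProd S.all) := by rw [hM]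
      rw [hM']
      exact hfinal
    linarith [hliou, hev_le, hmono, hfin]

end Setup

end Literature.NumberTheory.Transcendental.CW77

end
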